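import Literature.NumberTheory.LFunctions.ZetaGapRecordsRH
import Literature.NumberTheory.LFunctions.RiemannXiShiftInequality
import Mathlib.Analysis.Real.Pi.Bounds
import Mathlib.Analysis.SpecialFunctions.Trigonometric.Sinc
import Mathlib.MeasureTheory.Integral.DominatedConvergence

/-!
# Inoue 2026 — the numerical input of the deduction of Theorem 1 from Theorem 2, certified in the kernel

S. Inoue, *On the small gaps between zeros of the Riemann zeta-function* (title as in the records file),
arXiv:2604.05733 (2026, preprint under review) [Inoue2026], proof of Theorem 1, p. 3: "Applying
Theorem 2 with `φ = 0.508949`, `ℓ = 1.15`, and `f(x) = 1 + c₁x` for `c₁ = −0.7`, we have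
`sup_{t∈[T,2T]} (N_h(t)² − N_h(t)) ≥ I_f(ℓ)⁻¹𝓜_{ℓ,f}(φ) − φ(1−φ) − o(1) ≥ 10⁻⁵ > 0`".  The records
file `ZetaGapRecordsRH` types the numerical evaluation "`≥ 10⁻⁵`" as the closed-form real inequality
`inoue2026_numericalBound : 10⁻⁵ ≤ 𝓜_{ℓ,f}(φ)/I_f(ℓ) − φ(1−φ)` at the printed parameters (node of the
rh-crit/ah register, class N "numerical in print"; the three nested integrals `Inoue2026.M` are typed
verbatim, correctly parenthesised since records v4 — cell erratum E-ah-7: under the v1–v3 typing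
Mathlib's `∫ x in a..b, r` swallowed the following `+` summands into the innermost integrand and the
statement was false; v4 restored the printed three-term sum, `Inoue2026.M_eq_sum`).  THIS FILE PROVES
IT: `inoue2026_numericalBound_holds : inoue2026_numericalBound` — interval-free, `ζ`-free real
arithmetic checked by the kernel.  Consequently Inoue's Theorem 1 (`μ < 0.50895` on RH,
`inoue2026_theorem1`) is a tree theorem MODULO the single claim `inoue2026_theorem2`
(`inoue2026_theorem1_of_theorem2'`).

LABEL (rh-crit C5, LADDER-RH §4 HELD «conditional bridges: exceptional zero ⇒ …»): NOT RH-BEARING.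
WHAT THIS IS NOT: an inequality between explicit real numbers (three nested integrals of the linear test
function `1 − 0.7x` against `v^{ℓ²−1}` and `sin(πφu)/u`); it certifies one line of a preprint's
deduction of `μ ≤ 0.508949` from its Theorem 2 and says nothing about RH, the zeros of `ζ`, or the
Alternative Hypothesis.  Nothing here bears on the truth of RH.

## The certified computation (one-sided; no interval arithmetic)

With `φ = 508949/10⁶`, `ℓ = 23/20` (`ℓ² = 529/400`, `s := ℓ² − 1 = 129/400`), `c = −7/10`:

* `I_f = ∫₀¹ (1 + cv)² v^s dv = 400/529 − 560/929 + 196/1329` (`If_f₀`), by `∫₀^a v^r = a^{r+1}/(r+1)`.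
* The three inner `v`-integrals of `𝓜` are closed forms in `(1−u)^{s+k}`, `k = 1,2,3`
  (`inner_poly_rpow`), and are `≥ 0` (the integrands are, `f ≥ 0.3` on `[0,1]`).
* `sin x ≥ S₇(x) = x − x³/6 + x⁵/120 − x⁷/5040` and `cos y ≤ C₁₂(y) = Σ_{n≤6} (−1)ⁿy^{2n}/(2n)!` on
  `[0,∞)` (the alternating-Taylor sign kernel, as in `BondarenkoHeap2026Numerics`; RANGE LEMMAS
  `sinTaylor7_le_sin`, `cos_le_cosTaylor12` on `[0,∞)`, `sinTaylor7_nonneg` on `[0,2]`); hence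
  `sin(πφu)/u` and `sin²(πφu)/u = (1 − cos 2πφu)/(2u)` are bounded BELOW by even/odd polynomials in `u`
  on `(0,1]`, the first of which is `≥ 0` there (`πφ ≤ 2`).  Monotone replacement (all three inner
  integrals `≥ 0`; in the double integral BOTH `sin` factors are replaced, which needs the sign of the
  minorant AND of the inner integral — both proved) gives `𝓜 ≥ 𝓜_low`.  Higher orders (`S₁₅`, `C₂₀`)
  would only move the certified slack from `1.40·10⁻⁶` to `1.47·10⁻⁶` (in `𝓜`-units).
* Every integral left is a Beta value `∫₀¹ uⁿ(1−u)^t du = n!/∏_{i≤n}(t+1+i)` with `t ∈ 529/400 + ℕ`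
  RATIONAL (`integral_pow_mul_one_sub_rpow`, from the tree's `integral_rpow_mul_one_sub_rpow`); the
  double integral is reduced by the scaling `u₂ = (1−u₁)y` (`integral_pow_mul_sub_rpow`).  So
  `𝓜_low = Σ_j C_j π^{2j}` with explicit rationals `C_j`, `j ≤ 6`.
* `π` is enclosed by `Real.pi_gt_d20 / Real.pi_lt_d20`; after multiplying by `π² I_f > 0` the
  inequality is an even polynomial inequality in `π` with rational coefficients, expanded by
  `norm_num` and closed by `linarith` on the monomials `π^{2j}`, `j ≤ 7` (no `decide`, no interval
  arithmetic).  Margins (seat numerics, exact rationals, UNCERTIFIED outside the kernel): true value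
  `𝓜/I_f − φ(1−φ) = 1.48716·10⁻⁵` (`𝓜 = 0.0751864490…`, `I_f = 196475876/653125089`; agrees with the
  cell's engine cross-check cc/engine/in26 to 20 digits); certified `𝓜_low/I_f − φ(1−φ) − 10⁻⁵ =
  4.64·10⁻⁶` (`1.40·10⁻⁶` in `𝓜`-units).

[cite: Inoue2026, proof of Theorem 1 p. 3 ("≥ 10⁻⁵ > 0")]
-/

noncomputable section

open MeasureTheory Set Finset Real

open scoped Real Interval

namespace Literature.NumberTheory.LFunctions

namespace Inoue2026.Numerics

/-! ### 1. The alternating Taylor bounds for `sin` and `cos` on `[0, ∞)` (sign kernel) -/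

/-- kernel (calculus): `d/dx Σ_{n≤N} (−1)ⁿx^{2n+1}/(2n+1)! = Σ_{n≤N} (−1)ⁿx^{2n}/(2n)!`. [folklore] -/
private theorem hasDerivAt_sinTaylor (N : ℕ) (x : ℝ) :
    HasDerivAt (fun y : ℝ => ∑ n ∈ range (N + 1), (-1 : ℝ) ^ n * y ^ (2 * n + 1) / ((2 * n + 1).factorial : ℝ))
      (∑ n ∈ range (N + 1), (-1 : ℝ) ^ n * x ^ (2 * n) / ((2 * n).factorial : ℝ)) x := by
  apply HasDerivAt.fun_sum
  intro n _
  refine (((hasDerivAt_pow (2 * n + 1) x).const_mul ((-1 : ℝ) ^ n)).div_const ((2 * n + 1).factorial : ℝ)).congr_deriv ?_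
  rw [Nat.factorial_succ, Nat.add_sub_cancel]
  have h1 : ((2 * n).factorial : ℝ) ≠ 0 := by positivity
  push_cast
  field_simp

/-- kernel (calculus): `d/dx Σ_{n≤N+1} (−1)ⁿx^{2n}/(2n)! = −Σ_{n≤N} (−1)ⁿx^{2n+1}/(2n+1)!`. [folklore] -/
private theorem hasDerivAt_cosTaylor (N : ℕ) (x : ℝ) :
    HasDerivAt (fun y : ℝ => ∑ n ∈ range (N + 2), (-1 : ℝ) ^ n * y ^ (2 * n) / ((2 * n).factorial : ℝ))
      (-(∑ n ∈ range (N + 1), (-1 : ℝ) ^ n * x ^ (2 * n + 1) / ((2 * n + 1).factorial : ℝ))) x := by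
  have h : HasDerivAt (fun y : ℝ => ∑ n ∈ range (N + 2), (-1 : ℝ) ^ n * y ^ (2 * n) / ((2 * n).factorial : ℝ))
      (∑ n ∈ range (N + 2), (-1 : ℝ) ^ n * (((2 * n : ℕ) : ℝ) * x ^ (2 * n - 1)) / ((2 * n).factorial : ℝ)) x := by
    apply HasDerivAt.fun_sum
    intro n _
    exact ((hasDerivAt_pow (2 * n) x).const_mul ((-1 : ℝ) ^ n)).div_const _
  refine h.congr_deriv ?_
  rw [Finset.sum_range_succ' (fun n => (-1 : ℝ) ^ n * (((2 * n : ℕ) : ℝ) * x ^ (2 * n - 1)) / ((2 * n).factorial : ℝ))]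
  simp only [mul_zero, Nat.cast_zero, zero_mul, zero_div, add_zero]
  rw [← Finset.sum_neg_distrib]
  refine Finset.sum_congr rfl fun n _ => ?_
  have e1 : 2 * (n + 1) - 1 = 2 * n + 1 := by omega
  have e2 : (2 * (n + 1)).factorial = (2 * n + 2) * (2 * n + 1).factorial := by
    rw [show 2 * (n + 1) = (2 * n + 1) + 1 by ring, Nat.factorial_succ]
  rw [e1, e2, pow_succ (-1 : ℝ) n]
  have h1 : ((2 * n + 1).factorial : ℝ) ≠ 0 := by positivity
  have h2 : (2 * (n : ℝ) + 2) ≠ 0 := by positivity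
  push_cast
  field_simp

/-- kernel (calculus): a function vanishing at `0` whose derivative is `≥ 0` on `[0, ∞)` is `≥ 0`
on `[0, ∞)`. [folklore] -/
private theorem nonneg_of_hasDerivAt_nonneg {g g' : ℝ → ℝ} (hd : ∀ x, HasDerivAt g (g' x) x)
    (hg' : ∀ x, 0 ≤ x → 0 ≤ g' x) (h0 : g 0 = 0) (x : ℝ) (hx : 0 ≤ x) : 0 ≤ g x := by
  have hmono : MonotoneOn g (Set.Ici 0) :=
    monotoneOn_of_hasDerivWithinAt_nonneg (convex_Ici 0) (fun y _ => (hd y).continuousAt.continuousWithinAt)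
      (fun y _ => (hd y).hasDerivWithinAt) (fun y hy => hg' y (le_of_lt (by simpa [interior_Ici] using hy)))
  simpa [h0] using hmono Set.self_mem_Ici hx hx

/-- kernel (calculus): sign of the `cos` remainder of order `2N` ⇒ sign of the `sin` remainder of
order `2N+1`. [folklore] -/
private theorem sinTaylor_sign_of_cosTaylor_sign (N : ℕ)
    (h : ∀ x : ℝ, 0 ≤ x →
      0 ≤ (-1 : ℝ) ^ (N + 1) * (Real.cos x - ∑ n ∈ range (N + 1), (-1 : ℝ) ^ n * x ^ (2 * n) / ((2 * n).factorial : ℝ))) :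
    ∀ x : ℝ, 0 ≤ x →
      0 ≤ (-1 : ℝ) ^ (N + 1) * (Real.sin x - ∑ n ∈ range (N + 1), (-1 : ℝ) ^ n * x ^ (2 * n + 1) / ((2 * n + 1).factorial : ℝ)) :=
  nonneg_of_hasDerivAt_nonneg (fun x => ((Real.hasDerivAt_sin x).sub (hasDerivAt_sinTaylor N x)).const_mul _) h
    (by simp)

/-- kernel (calculus): sign of the `sin` remainder of order `2N+1` ⇒ sign of the `cos` remainder of
order `2N+2`. [folklore] -/
private theorem cosTaylor_sign_succ_of_sinTaylor_sign (N : ℕ)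
    (h : ∀ x : ℝ, 0 ≤ x →
      0 ≤ (-1 : ℝ) ^ (N + 1) * (Real.sin x - ∑ n ∈ range (N + 1), (-1 : ℝ) ^ n * x ^ (2 * n + 1) / ((2 * n + 1).factorial : ℝ))) :
    ∀ x : ℝ, 0 ≤ x →
      0 ≤ (-1 : ℝ) ^ (N + 2) * (Real.cos x - ∑ n ∈ range (N + 2), (-1 : ℝ) ^ n * x ^ (2 * n) / ((2 * n).factorial : ℝ)) := by
  refine nonneg_of_hasDerivAt_nonneg (fun x => ((Real.hasDerivAt_cos x).sub (hasDerivAt_cosTaylor N x)).const_mul _)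
    (fun x hx => ?_) (by simp [Finset.sum_range_succ'])
  have e : (-1 : ℝ) ^ (N + 2) *
      (-Real.sin x - -(∑ n ∈ range (N + 1), (-1 : ℝ) ^ n * x ^ (2 * n + 1) / ((2 * n + 1).factorial : ℝ)))
      = (-1 : ℝ) ^ (N + 1) *
        (Real.sin x - ∑ n ∈ range (N + 1), (-1 : ℝ) ^ n * x ^ (2 * n + 1) / ((2 * n + 1).factorial : ℝ)) := by
    rw [pow_succ]; ring
  rw [e]; exact h x hx

/-- kernel (calculus): for `x ≥ 0` the remainder `cos x − Σ_{n≤N} (−1)ⁿx^{2n}/(2n)!` has the sign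
`(−1)^{N+1}` of the first omitted term. [folklore] -/
private theorem cosTaylor_sign : ∀ (N : ℕ) (x : ℝ), 0 ≤ x →
    0 ≤ (-1 : ℝ) ^ (N + 1) * (Real.cos x - ∑ n ∈ range (N + 1), (-1 : ℝ) ^ n * x ^ (2 * n) / ((2 * n).factorial : ℝ))
  | 0, x, _ => by
    have := Real.cos_le_one x
    simp only [zero_add, pow_one, Finset.sum_range_one, pow_zero, mul_zero, Nat.factorial_zero, Nat.cast_one,
      div_one, mul_one]
    linarith
  | N + 1, x, hx =>
    cosTaylor_sign_succ_of_sinTaylor_sign N (sinTaylor_sign_of_cosTaylor_sign N fun y hy => cosTaylor_sign N y hy) x hx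

/-- kernel (calculus): for `x ≥ 0` the remainder `sin x − Σ_{n≤N} (−1)ⁿx^{2n+1}/(2n+1)!` has the
sign `(−1)^{N+1}`. [folklore] -/
private theorem sinTaylor_sign (N : ℕ) (x : ℝ) (hx : 0 ≤ x) :
    0 ≤ (-1 : ℝ) ^ (N + 1) *
      (Real.sin x - ∑ n ∈ range (N + 1), (-1 : ℝ) ^ n * x ^ (2 * n + 1) / ((2 * n + 1).factorial : ℝ)) :=
  sinTaylor_sign_of_cosTaylor_sign N (cosTaylor_sign N) x hx

/-- `Σ_{n<4} (−1)ⁿ x^{2n+1}/(2n+1)! ≤ sin x` for `x ≥ 0` (degree-7 Taylor minorant). [folklore] -/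
private theorem sinTaylor7_le_sin (x : ℝ) (hx : 0 ≤ x) :
    ∑ n ∈ range 4, (-1 : ℝ) ^ n * x ^ (2 * n + 1) / ((2 * n + 1).factorial : ℝ) ≤ Real.sin x := by
  have h := sinTaylor_sign 3 x hx
  have e : (-1 : ℝ) ^ (3 + 1) = 1 := by norm_num
  rw [e, one_mul] at h
  linarith

/-- `cos y ≤ Σ_{n<7} (−1)ⁿ y^{2n}/(2n)!` for `y ≥ 0` (degree-12 Taylor majorant). [folklore] -/
private theorem cos_le_cosTaylor12 (y : ℝ) (hy : 0 ≤ y) :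
    Real.cos y ≤ ∑ n ∈ range 7, (-1 : ℝ) ^ n * y ^ (2 * n) / ((2 * n).factorial : ℝ) := by
  have h := cosTaylor_sign 6 y hy
  have e : (-1 : ℝ) ^ (6 + 1) = -1 := by norm_num
  rw [e] at h
  linarith

/-- The degree-7 minorant is non-negative on `[0, 2]`: pair the terms. [folklore] -/
private theorem sinTaylor7_nonneg (x : ℝ) (hx : 0 ≤ x) (hx2 : x ≤ 2) :
    0 ≤ ∑ n ∈ range 4, (-1 : ℝ) ^ n * x ^ (2 * n + 1) / ((2 * n + 1).factorial : ℝ) := by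
  simp only [Finset.sum_range_succ, Finset.sum_range_zero, zero_add]
  norm_num [Nat.factorial]
  have h1 : 0 ≤ x * (6 - x ^ 2) := mul_nonneg hx (by nlinarith)
  have h2 : 0 ≤ x ^ 5 * (42 - x ^ 2) := mul_nonneg (by positivity) (by nlinarith)
  nlinarith [h1, h2]

/-! ### 2. Beta integrals with one natural exponent: `∫₀¹ uⁿ(1−u)^t du = n!/∏_{i≤n}(t+1+i)` -/

/-- `Γ(n + 1 + (t + 1)) = (∏_{i≤n} (t+1+i)) · Γ(t+1)` for `t > −1`. [folklore] -/
private theorem Gamma_nat_add (n : ℕ) {t : ℝ} (ht : -1 < t) :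
    Real.Gamma ((n : ℝ) + 1 + (t + 1)) = (∏ i ∈ range (n + 1), (t + 1 + i)) * Real.Gamma (t + 1) := by
  induction n with
  | zero =>
    simp only [Nat.cast_zero, zero_add, Finset.range_one, Finset.prod_singleton, add_zero]
    rw [show (1 : ℝ) + (t + 1) = (t + 1) + 1 by ring, Real.Gamma_add_one (by linarith : (0 : ℝ) < t + 1).ne']
  | succ n ih =>
    rw [Finset.prod_range_succ, show ((n + 1 : ℕ) : ℝ) + 1 + (t + 1) = ((n : ℝ) + 1 + (t + 1)) + 1 by
      push_cast; ring, Real.Gamma_add_one (by have h0 : (0 : ℝ) ≤ n := n.cast_nonneg; exact (by linarith : (0 : ℝ) < (n : ℝ) + 1 + (t + 1)).ne'), ih]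
    push_cast
    ring

/-- **Beta value with one natural exponent**: `∫₀¹ uⁿ (1−u)^t du = n! / ∏_{i=0}^{n} (t+1+i)` for real
`t > 0` (from the tree's `integral_rpow_mul_one_sub_rpow`, i.e. `B(n+1,t+1) = Γ(n+1)Γ(t+1)/Γ(n+t+2)`
and the recurrence of `Γ`). [cite: AbramowitzStegun1964, 6.2.1–6.2.2 and 6.1.15] -/
theorem integral_pow_mul_one_sub_rpow (n : ℕ) {t : ℝ} (ht : 0 < t) :
    ∫ u in (0 : ℝ)..1, u ^ n * (1 - u) ^ t = (n.factorial : ℝ) / ∏ i ∈ range (n + 1), (t + 1 + i) := by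
  have h := integral_rpow_mul_one_sub_rpow (a := (n : ℝ) + 1) (b := t + 1) (by positivity) (by linarith)
  simp only [add_sub_cancel_right] at h
  have h' : ∫ u in (0 : ℝ)..1, u ^ n * (1 - u) ^ t = ∫ u in (0 : ℝ)..1, u ^ (n : ℝ) * (1 - u) ^ t := by
    congr 1; ext u; rw [Real.rpow_natCast]
  rw [h', h, Real.Gamma_nat_eq_factorial, Gamma_nat_add n (by linarith : (-1 : ℝ) < t)]
  have hΓ : Real.Gamma (t + 1) ≠ 0 := (Real.Gamma_pos_of_pos (by linarith)).ne'
  have hP : (∏ i ∈ range (n + 1), (t + 1 + (i : ℝ))) ≠ 0 :=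
    Finset.prod_ne_zero_iff.2 fun i _ => by positivity
  field_simp

/-- Scaled Beta value: `∫₀^b xⁿ (b−x)^t dx = b^{n+1} b^t · n!/∏_{i≤n}(t+1+i)` for `b ≥ 0`, `t > 0`
(substitution `x = by`). [cite: AbramowitzStegun1964, 6.2.1–6.2.2] -/
theorem integral_pow_mul_sub_rpow (n : ℕ) {t : ℝ} (ht : 0 < t) {b : ℝ} (hb : 0 ≤ b) :
    ∫ x in (0 : ℝ)..b, x ^ n * (b - x) ^ t =
      b ^ (n + 1) * b ^ t * ((n.factorial : ℝ) / ∏ i ∈ range (n + 1), (t + 1 + i)) := by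
  rcases hb.eq_or_lt with rfl | hb'
  · simp [zero_pow (Nat.succ_ne_zero n)]
  have hsub : ∫ x in (0 : ℝ)..b, x ^ n * (b - x) ^ t =
      b * ∫ y in (0 : ℝ)..1, (b * y) ^ n * (b - b * y) ^ t := by
    rw [intervalIntegral.mul_integral_comp_mul_left (f := fun x => x ^ n * (b - x) ^ t)]
    simp
  rw [hsub, ← integral_pow_mul_one_sub_rpow n ht, ← intervalIntegral.integral_const_mul,
    ← intervalIntegral.integral_const_mul]
  refine intervalIntegral.integral_congr fun y hy => ?_
  rw [Set.uIcc_of_le zero_le_one] at hy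
  have hy1 : 0 ≤ 1 - y := by linarith [hy.2]
  rw [show b - b * y = b * (1 - y) by ring, Real.mul_rpow hb'.le hy1, mul_pow]
  ring

/-! ### 3. Continuity helpers and the generic "polynomial × linear × power" integrals -/

/-- `u ↦ (b − u)^t` is continuous for `t ≥ 0`. [folklore] -/
private theorem continuous_sub_rpow (b : ℝ) {t : ℝ} (ht : 0 ≤ t) :
    Continuous fun u : ℝ => (b - u) ^ t :=
  (continuous_const.sub continuous_id).rpow_const fun _ => Or.inr ht

/-- **Generic 1D evaluation**: `∫₀¹ (Σ_{n<N} aₙ u^{dₙ}) · (α + βu)(1−u)^t du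
  = Σ_{n<N} aₙ (α·J(dₙ,t) + β·J(dₙ+1,t))`, `J(k,t) = k!/∏_{i≤k}(t+1+i)`. [folklore] -/
private theorem integral_polySum_mul_linear_mul_rpow (N : ℕ) (a : ℕ → ℝ) (d : ℕ → ℕ) (α β : ℝ) {t : ℝ}
    (ht : 0 < t) :
    ∫ u in (0 : ℝ)..1, (∑ n ∈ range N, a n * u ^ d n) * ((α + β * u) * (1 - u) ^ t)
      = ∑ n ∈ range N, a n *
          (α * ((d n).factorial / ∏ i ∈ range (d n + 1), (t + 1 + i)) +
            β * ((d n + 1).factorial / ∏ i ∈ range (d n + 2), (t + 1 + i))) := by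
  have hc : Continuous fun u : ℝ => (1 - u) ^ t := continuous_sub_rpow 1 ht.le
  have e1 : ∀ u : ℝ, (∑ n ∈ range N, a n * u ^ d n) * ((α + β * u) * (1 - u) ^ t)
      = ∑ n ∈ range N, a n * (α * (u ^ d n * (1 - u) ^ t) + β * (u ^ (d n + 1) * (1 - u) ^ t)) := by
    intro u; rw [Finset.sum_mul]; refine Finset.sum_congr rfl fun n _ => ?_; ring
  simp_rw [e1]
  rw [intervalIntegral.integral_finsetSum]
  · refine Finset.sum_congr rfl fun n _ => ?_
    rw [intervalIntegral.integral_const_mul, intervalIntegral.integral_add,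
      intervalIntegral.integral_const_mul, intervalIntegral.integral_const_mul,
      integral_pow_mul_one_sub_rpow (d n) ht, integral_pow_mul_one_sub_rpow (d n + 1) ht]
    · exact (Continuous.intervalIntegrable (by fun_prop) _ _)
    · exact (Continuous.intervalIntegrable (by fun_prop) _ _)
  · intro n _
    exact (Continuous.intervalIntegrable (by fun_prop) _ _)

/-- **Generic scaled 1D evaluation**: `∫₀^b (Σ_{n<N} aₙ x^{dₙ}) · (α + βx)(b−x)^t dx
  = Σ_{n<N} aₙ (α b^{dₙ+1} b^t J(dₙ,t) + β b^{dₙ+2} b^t J(dₙ+1,t))` (`b ≥ 0`). [folklore] -/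
private theorem integral_polySum_mul_linear_mul_sub_rpow (N : ℕ) (a : ℕ → ℝ) (d : ℕ → ℕ) (α β : ℝ) {t : ℝ}
    (ht : 0 < t) {b : ℝ} (hb : 0 ≤ b) :
    ∫ x in (0 : ℝ)..b, (∑ n ∈ range N, a n * x ^ d n) * ((α + β * x) * (b - x) ^ t)
      = ∑ n ∈ range N, a n *
          (α * (b ^ (d n + 1) * b ^ t * ((d n).factorial / ∏ i ∈ range (d n + 1), (t + 1 + i))) +
            β * (b ^ (d n + 2) * b ^ t * ((d n + 1).factorial / ∏ i ∈ range (d n + 2), (t + 1 + i)))) := by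
  have hc : Continuous fun u : ℝ => (b - u) ^ t := continuous_sub_rpow b ht.le
  have e1 : ∀ u : ℝ, (∑ n ∈ range N, a n * u ^ d n) * ((α + β * u) * (b - u) ^ t)
      = ∑ n ∈ range N, a n * (α * (u ^ d n * (b - u) ^ t) + β * (u ^ (d n + 1) * (b - u) ^ t)) := by
    intro u; rw [Finset.sum_mul]; refine Finset.sum_congr rfl fun n _ => ?_; ring
  simp_rw [e1]
  rw [intervalIntegral.integral_finsetSum]
  · refine Finset.sum_congr rfl fun n _ => ?_
    rw [intervalIntegral.integral_const_mul, intervalIntegral.integral_add,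
      intervalIntegral.integral_const_mul, intervalIntegral.integral_const_mul,
      integral_pow_mul_sub_rpow (d n) ht hb, integral_pow_mul_sub_rpow (d n + 1) ht hb]
    · exact (Continuous.intervalIntegrable (by fun_prop) _ _)
    · exact (Continuous.intervalIntegrable (by fun_prop) _ _)
  · intro n _
    exact (Continuous.intervalIntegrable (by fun_prop) _ _)

/-! ### 4. The inner `v`-integrals in closed form -/

/-- `∫₀^a (P₀ + P₁v + P₂v²) v^s dv = P₀ a^{s+1}/(s+1) + P₁ a^{s+2}/(s+2) + P₂ a^{s+3}/(s+3)` for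
`a ≥ 0`, `s > 0`. [folklore] -/
private theorem inner_poly_rpow {s a : ℝ} (hs : 0 < s) (ha : 0 ≤ a) (P₀ P₁ P₂ : ℝ) :
    ∫ v in (0 : ℝ)..a, (P₀ + P₁ * v + P₂ * v ^ 2) * v ^ s
      = P₀ * (a ^ (s + 1) / (s + 1)) + P₁ * (a ^ (s + 2) / (s + 2)) + P₂ * (a ^ (s + 3) / (s + 3)) := by
  have hI : ∀ r : ℝ, 0 < r → ∫ v in (0 : ℝ)..a, v ^ r = a ^ (r + 1) / (r + 1) := by
    intro r hr
    rw [integral_rpow (Or.inl (by linarith))]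
    rw [Real.zero_rpow (by linarith)]; ring
  have e : ∫ v in (0 : ℝ)..a, (P₀ + P₁ * v + P₂ * v ^ 2) * v ^ s
      = ∫ v in (0 : ℝ)..a, P₀ * v ^ s + P₁ * v ^ (s + 1) + P₂ * v ^ (s + 2) := by
    refine intervalIntegral.integral_congr fun v hv => ?_
    rw [Set.uIcc_of_le ha] at hv
    have hv0 : 0 ≤ v := hv.1
    rw [Real.rpow_add_of_nonneg hv0 hs.le zero_le_one, Real.rpow_one,
      Real.rpow_add_of_nonneg hv0 hs.le zero_le_two, Real.rpow_two]
    ring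
  have hi : ∀ r : ℝ, 0 < r → IntervalIntegrable (fun v : ℝ => v ^ r) volume 0 a :=
    fun r hr => intervalIntegral.intervalIntegrable_rpow' (by linarith)
  rw [e, intervalIntegral.integral_add, intervalIntegral.integral_add, intervalIntegral.integral_const_mul,
    intervalIntegral.integral_const_mul, intervalIntegral.integral_const_mul, hI s hs,
    hI (s + 1) (by linarith), hI (s + 2) (by linarith)]
  · ring_nf
  · exact (hi s hs).const_mul _
  · exact (hi (s + 1) (by linarith)).const_mul _
  · exact ((hi s hs).const_mul _).add ((hi (s + 1) (by linarith)).const_mul _)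
  · exact (hi (s + 2) (by linarith)).const_mul _

/-! ### 5. The test function `f₀ = 1 − 0.7x` and the polynomial minorants -/

/-- `f₀ x = 1 − (7/10)x`. [claim: Inoue2026, status: under-review] -/
theorem f₀_eq (x : ℝ) : Inoue2026.f₀ x = 1 - 7 / 10 * x := by
  unfold Inoue2026.f₀; norm_num

/-- `f₀ ≥ 0` on `(-∞, 10/7]`, in particular on `[0, 1]`. [claim: Inoue2026, status: under-review] -/
theorem f₀_nonneg {x : ℝ} (h1 : x ≤ 1) : 0 ≤ Inoue2026.f₀ x := by
  rw [f₀_eq]; linarith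

/-- The minorant of `sin(xu)/u`: `Σ_{n<4} (−1)ⁿ x^{2n+1} u^{2n}/(2n+1)! ≤ sin(xu)/u` for `x ≥ 0`,
`u > 0`. [folklore] -/
private theorem polyS_le_sin_div {x u : ℝ} (hx : 0 ≤ x) (hu : 0 < u) :
    ∑ n ∈ range 4, (-1 : ℝ) ^ n * x ^ (2 * n + 1) / ((2 * n + 1).factorial : ℝ) * u ^ (2 * n)
      ≤ Real.sin (x * u) / u := by
  rw [le_div_iff₀ hu, Finset.sum_mul]
  calc ∑ n ∈ range 4, (-1 : ℝ) ^ n * x ^ (2 * n + 1) / ((2 * n + 1).factorial : ℝ) * u ^ (2 * n) * u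
      = ∑ n ∈ range 4, (-1 : ℝ) ^ n * (x * u) ^ (2 * n + 1) / ((2 * n + 1).factorial : ℝ) := by
        refine Finset.sum_congr rfl fun n _ => ?_
        rw [mul_pow, pow_succ u (2 * n)]; ring
    _ ≤ Real.sin (x * u) := sinTaylor7_le_sin (x * u) (by positivity)

/-- The minorant of `sin(xu)/u` is `≥ 0` for `0 ≤ x ≤ 2`, `0 ≤ u ≤ 1`. [folklore] -/
private theorem polyS_nonneg {x u : ℝ} (hx : 0 ≤ x) (hx2 : x ≤ 2) (hu0 : 0 ≤ u) (hu1 : u ≤ 1) :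
    0 ≤ ∑ n ∈ range 4, (-1 : ℝ) ^ n * x ^ (2 * n + 1) / ((2 * n + 1).factorial : ℝ) * u ^ (2 * n) := by
  rcases hu0.eq_or_lt with rfl | hu
  · simp [Finset.sum_range_succ]
    exact hx
  · have h := sinTaylor7_nonneg (x * u) (by positivity)
      (by nlinarith [mul_le_mul hx2 hu1 hu.le (by norm_num : (0:ℝ) ≤ 2)])
    have e : ∑ n ∈ range 4, (-1 : ℝ) ^ n * x ^ (2 * n + 1) / ((2 * n + 1).factorial : ℝ) * u ^ (2 * n)
        = (∑ n ∈ range 4, (-1 : ℝ) ^ n * (x * u) ^ (2 * n + 1) / ((2 * n + 1).factorial : ℝ)) / u := by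
      rw [eq_div_iff hu.ne', Finset.sum_mul]
      refine Finset.sum_congr rfl fun n _ => ?_
      rw [mul_pow, pow_succ u (2 * n)]; ring
    rw [e]; exact div_nonneg h hu.le

/-- The minorant of `sin²(xu)/u`: `Σ_{k<6} (−1)ᵏ (2x)^{2k+2} u^{2k+1}/(2·(2k+2)!) ≤ sin²(xu)/u` for
`x ≥ 0`, `u > 0` (`sin² = (1 − cos 2·)/2` and the degree-12 majorant of `cos`). [folklore] -/
private theorem polyC_le_sin_sq_div {x u : ℝ} (hx : 0 ≤ x) (hu : 0 < u) :
    ∑ k ∈ range 6, (-1 : ℝ) ^ k * (2 * x) ^ (2 * k + 2) / (2 * ((2 * k + 2).factorial : ℝ)) * u ^ (2 * k + 1)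
      ≤ Real.sin (x * u) ^ 2 / u := by
  have hcos := cos_le_cosTaylor12 (2 * (x * u)) (by positivity)
  have hsq : Real.sin (x * u) ^ 2 = 1 / 2 - Real.cos (2 * (x * u)) / 2 := by
    rw [Real.sin_sq, Real.cos_sq]; ring
  rw [le_div_iff₀ hu, Finset.sum_mul, hsq]
  have e : ∑ k ∈ range 6, (-1 : ℝ) ^ k * (2 * x) ^ (2 * k + 2) / (2 * ((2 * k + 2).factorial : ℝ)) *
        u ^ (2 * k + 1) * u
      = 1 / 2 - (∑ n ∈ range 7, (-1 : ℝ) ^ n * (2 * (x * u)) ^ (2 * n) / ((2 * n).factorial : ℝ)) / 2 := by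
    simp only [Finset.sum_range_succ, Finset.sum_range_zero]
    norm_num [Nat.factorial]
    ring
  rw [e]
  linarith

/-! ### 6. Term `T_C`: `∫₀¹ (sin²(xu)/u) ∫₀^{1−u} f₀(v)² v^s dv du` bounded below -/

/-- Closed form of the inner integral of `T_C`: for `u ≤ 1`,
`∫₀^{1−u} f₀(v)² v^{129/400} dv = (1−u)^{529/400}/(529/400) − (7/5)(1−u)^{929/400}/(929/400)
 + (49/100)(1−u)^{1329/400}/(1329/400)`. [claim: Inoue2026, status: under-review] -/
theorem innerC_eq {u : ℝ} (hu : u ≤ 1) :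
    ∫ v in (0 : ℝ)..(1 - u), Inoue2026.f₀ v ^ 2 * v ^ (129 / 400 : ℝ)
      = 1 * ((1 - u) ^ (529 / 400 : ℝ) / (529 / 400)) + (-7 / 5) * ((1 - u) ^ (929 / 400 : ℝ) / (929 / 400))
        + 49 / 100 * ((1 - u) ^ (1329 / 400 : ℝ) / (1329 / 400)) := by
  have e : (fun v : ℝ => Inoue2026.f₀ v ^ 2 * v ^ (129 / 400 : ℝ))
      = fun v => (1 + (-7 / 5) * v + 49 / 100 * v ^ 2) * v ^ (129 / 400 : ℝ) := by
    ext v; rw [f₀_eq]; ring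
  rw [e, inner_poly_rpow (by norm_num) (by linarith)]
  norm_num

/-- The inner integral of `T_C` is `≥ 0` for `u ≤ 1`. [claim: Inoue2026, status: under-review] -/
theorem innerC_nonneg {u : ℝ} (hu : u ≤ 1) :
    0 ≤ ∫ v in (0 : ℝ)..(1 - u), Inoue2026.f₀ v ^ 2 * v ^ (129 / 400 : ℝ) :=
  intervalIntegral.integral_nonneg (by linarith) fun v hv =>
    mul_nonneg (sq_nonneg _) (Real.rpow_nonneg hv.1 _)

/-- **`T_C` lower bound**: for `0 < x`,
`Σ_{k<6} (−1)ᵏ(2x)^{2k+2}/(2(2k+2)!) · c_k ≤ ∫₀¹ (sin²(xu)/u) ∫₀^{1−u} f₀² v^{129/400}`, with the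
rational moments `c_k = ∫₀¹ u^{2k+1} C(u) du` in Beta form. [claim: Inoue2026, status: under-review] -/
theorem termC_lower {x : ℝ} (hx : 0 < x) :
    (400 / 529 * ∑ k ∈ range 6, (-1 : ℝ) ^ k * (2 * x) ^ (2 * k + 2) / (2 * ((2 * k + 2).factorial : ℝ)) *
        (1 * (((2 * k + 1).factorial : ℝ) / ∏ i ∈ range (2 * k + 1 + 1), ((529 / 400 : ℝ) + 1 + i)) +
          0 * (((2 * k + 1 + 1).factorial : ℝ) / ∏ i ∈ range (2 * k + 1 + 2), ((529 / 400 : ℝ) + 1 + i))) +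
      400 / 929 * ∑ k ∈ range 6, (-1 : ℝ) ^ k * (2 * x) ^ (2 * k + 2) / (2 * ((2 * k + 2).factorial : ℝ)) *
        (-7 / 5 * (((2 * k + 1).factorial : ℝ) / ∏ i ∈ range (2 * k + 1 + 1), ((929 / 400 : ℝ) + 1 + i)) +
          0 * (((2 * k + 1 + 1).factorial : ℝ) / ∏ i ∈ range (2 * k + 1 + 2), ((929 / 400 : ℝ) + 1 + i))) +
      400 / 1329 * ∑ k ∈ range 6, (-1 : ℝ) ^ k * (2 * x) ^ (2 * k + 2) / (2 * ((2 * k + 2).factorial : ℝ)) *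
        (49 / 100 * (((2 * k + 1).factorial : ℝ) / ∏ i ∈ range (2 * k + 1 + 1), ((1329 / 400 : ℝ) + 1 + i)) +
          0 * (((2 * k + 1 + 1).factorial : ℝ) / ∏ i ∈ range (2 * k + 1 + 2), ((1329 / 400 : ℝ) + 1 + i))))
      ≤ ∫ u in (0 : ℝ)..1, Real.sin (x * u) ^ 2 / u *
          ∫ v in (0 : ℝ)..(1 - u), Inoue2026.f₀ v ^ 2 * v ^ (129 / 400 : ℝ) := by
  -- abbreviations
  set q : ℝ → ℝ := fun u => ∑ k ∈ range 6, (-1 : ℝ) ^ k * (2 * x) ^ (2 * k + 2) /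
    (2 * ((2 * k + 2).factorial : ℝ)) * u ^ (2 * k + 1) with hq
  set C : ℝ → ℝ := fun u => 1 * ((1 - u) ^ (529 / 400 : ℝ) / (529 / 400)) +
    (-7 / 5) * ((1 - u) ^ (929 / 400 : ℝ) / (929 / 400)) + 49 / 100 * ((1 - u) ^ (1329 / 400 : ℝ) / (1329 / 400))
    with hC
  -- Step 1: closed form of the inner integral on `[0,1]`
  have hcongr : ∫ u in (0 : ℝ)..1, Real.sin (x * u) ^ 2 / u *
        ∫ v in (0 : ℝ)..(1 - u), Inoue2026.f₀ v ^ 2 * v ^ (129 / 400 : ℝ)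
      = ∫ u in (0 : ℝ)..1, Real.sin (x * u) ^ 2 / u * C u := by
    refine intervalIntegral.integral_congr fun u hu => ?_
    rw [Set.uIcc_of_le zero_le_one] at hu
    simp only [hC]
    rw [innerC_eq hu.2]
  rw [hcongr]
  -- Step 2: the minorant integrates to the stated sum
  have h1c : Continuous fun u : ℝ => (1 - u) ^ (529 / 400 : ℝ) := continuous_sub_rpow 1 (by norm_num)
  have h2c : Continuous fun u : ℝ => (1 - u) ^ (929 / 400 : ℝ) := continuous_sub_rpow 1 (by norm_num)
  have h3c : Continuous fun u : ℝ => (1 - u) ^ (1329 / 400 : ℝ) := continuous_sub_rpow 1 (by norm_num)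
  have hqc : Continuous q := by simp only [hq]; fun_prop
  have hCc : Continuous C := by
    simp only [hC]
    exact (((continuous_const.mul (h1c.div_const _)).add (continuous_const.mul (h2c.div_const _))).add
      (continuous_const.mul (h3c.div_const _)))
  have heval : ∫ u in (0 : ℝ)..1, q u * C u
      = 400 / 529 * (∫ u in (0 : ℝ)..1, q u * ((1 + 0 * u) * (1 - u) ^ (529 / 400 : ℝ))) +
        400 / 929 * (∫ u in (0 : ℝ)..1, q u * ((-7 / 5 + 0 * u) * (1 - u) ^ (929 / 400 : ℝ))) +
        400 / 1329 * (∫ u in (0 : ℝ)..1, q u * ((49 / 100 + 0 * u) * (1 - u) ^ (1329 / 400 : ℝ))) := by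
    have e : ∀ u, q u * C u = 400 / 529 * (q u * ((1 + 0 * u) * (1 - u) ^ (529 / 400 : ℝ))) +
        400 / 929 * (q u * ((-7 / 5 + 0 * u) * (1 - u) ^ (929 / 400 : ℝ))) +
        400 / 1329 * (q u * ((49 / 100 + 0 * u) * (1 - u) ^ (1329 / 400 : ℝ))) := by
      intro u; simp only [hC]; ring
    simp_rw [e]
    have i1 : IntervalIntegrable (fun u => 400 / 529 * (q u * ((1 + 0 * u) * (1 - u) ^ (529 / 400 : ℝ))))
        volume 0 1 :=
      ((hqc.mul ((continuous_const.add (continuous_const.mul continuous_id)).mul h1c)).const_mul _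
        ).intervalIntegrable _ _
    have i2 : IntervalIntegrable (fun u => 400 / 929 * (q u * ((-7 / 5 + 0 * u) * (1 - u) ^ (929 / 400 : ℝ))))
        volume 0 1 :=
      ((hqc.mul ((continuous_const.add (continuous_const.mul continuous_id)).mul h2c)).const_mul _
        ).intervalIntegrable _ _
    have i3 : IntervalIntegrable (fun u => 400 / 1329 * (q u * ((49 / 100 + 0 * u) * (1 - u) ^ (1329 / 400 : ℝ))))
        volume 0 1 :=
      ((hqc.mul ((continuous_const.add (continuous_const.mul continuous_id)).mul h3c)).const_mul _
        ).intervalIntegrable _ _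
    rw [intervalIntegral.integral_add (i1.add i2) i3, intervalIntegral.integral_add i1 i2,
      intervalIntegral.integral_const_mul, intervalIntegral.integral_const_mul,
      intervalIntegral.integral_const_mul]
  -- Step 3: integrability of the true integrand and pointwise comparison on `(0,1)`
  have hgc : Continuous (fun u : ℝ => x * Real.sinc (x * u) * Real.sin (x * u) * C u) :=
    ((continuous_const.mul (Real.continuous_sinc.comp (continuous_const.mul continuous_id))).mul
      (Real.continuous_sin.comp (continuous_const.mul continuous_id))).mul hCc
  have hfg : EqOn (fun u : ℝ => x * Real.sinc (x * u) * Real.sin (x * u) * C u)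
      (fun u => Real.sin (x * u) ^ 2 / u * C u) (Ι (0 : ℝ) 1) := by
    intro u hu
    rw [Set.uIoc_of_le zero_le_one] at hu
    have hu0 : u ≠ 0 := hu.1.ne'
    simp only
    rw [Real.sinc_of_ne_zero (mul_ne_zero hx.ne' hu0)]
    field_simp
  have hfi : IntervalIntegrable (fun u => Real.sin (x * u) ^ 2 / u * C u) volume 0 1 :=
    (hgc.intervalIntegrable 0 1).congr hfg
  have hlow : ∫ u in (0 : ℝ)..1, q u * C u ≤ ∫ u in (0 : ℝ)..1, Real.sin (x * u) ^ 2 / u * C u := by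
    refine intervalIntegral.integral_mono_on_of_le_Ioo zero_le_one ((hqc.mul hCc).intervalIntegrable _ _) hfi
      fun u hu => ?_
    have hCu : 0 ≤ C u := by
      simp only [hC]; rw [← innerC_eq hu.2.le]; exact innerC_nonneg hu.2.le
    exact mul_le_mul_of_nonneg_right (polyC_le_sin_sq_div hx.le hu.1) hCu
  refine le_trans (le_of_eq ?_) hlow
  have hE : ∀ (α t : ℝ), 0 < t →
      ∫ u in (0 : ℝ)..1, q u * ((α + 0 * u) * (1 - u) ^ t)
        = ∑ k ∈ range 6, (-1 : ℝ) ^ k * (2 * x) ^ (2 * k + 2) / (2 * ((2 * k + 2).factorial : ℝ)) *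
          (α * (((2 * k + 1).factorial : ℝ) / ∏ i ∈ range (2 * k + 1 + 1), (t + 1 + i)) +
            0 * (((2 * k + 1 + 1).factorial : ℝ) / ∏ i ∈ range (2 * k + 1 + 2), (t + 1 + i))) := by
    intro α t ht
    simp only [hq]
    exact integral_polySum_mul_linear_mul_rpow 6
      (fun k => (-1 : ℝ) ^ k * (2 * x) ^ (2 * k + 2) / (2 * ((2 * k + 2).factorial : ℝ)))
      (fun k => 2 * k + 1) α 0 ht
  rw [heval, hE 1 (529 / 400) (by norm_num), hE (-7 / 5) (929 / 400) (by norm_num),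
    hE (49 / 100) (1329 / 400) (by norm_num)]

/-! ### 7. Term `T_A`: `∫₀¹ (sin(xu)/u) ∫₀^{1−u} f₀(v) f₀(u+v) v^s dv du` bounded below -/

/-- The `u`-integrals of the `sin` minorant against `(α + βu)(1−u)^t` (instance of the generic lemma).
[folklore] -/
private theorem integral_polyS_lin_rpow (x α β : ℝ) {t : ℝ} (ht : 0 < t) :
    ∫ u in (0 : ℝ)..1, (∑ n ∈ range 4, (-1 : ℝ) ^ n * x ^ (2 * n + 1) / ((2 * n + 1).factorial : ℝ) * u ^ (2 * n)) *
        ((α + β * u) * (1 - u) ^ t)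
      = ∑ n ∈ range 4, (-1 : ℝ) ^ n * x ^ (2 * n + 1) / ((2 * n + 1).factorial : ℝ) *
          (α * (((2 * n).factorial : ℝ) / ∏ i ∈ range (2 * n + 1), (t + 1 + i)) +
            β * (((2 * n + 1).factorial : ℝ) / ∏ i ∈ range (2 * n + 2), (t + 1 + i))) :=
  integral_polySum_mul_linear_mul_rpow 4
    (fun n => (-1 : ℝ) ^ n * x ^ (2 * n + 1) / ((2 * n + 1).factorial : ℝ)) (fun n => 2 * n) α β ht

/-- The scaled version on `[0, b]` against `(α + βu)(b−u)^t`. [folklore] -/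
private theorem integral_polyS_lin_sub_rpow (x α β : ℝ) {t : ℝ} (ht : 0 < t) {b : ℝ} (hb : 0 ≤ b) :
    ∫ u in (0 : ℝ)..b, (∑ n ∈ range 4, (-1 : ℝ) ^ n * x ^ (2 * n + 1) / ((2 * n + 1).factorial : ℝ) * u ^ (2 * n)) *
        ((α + β * u) * (b - u) ^ t)
      = ∑ n ∈ range 4, (-1 : ℝ) ^ n * x ^ (2 * n + 1) / ((2 * n + 1).factorial : ℝ) *
          (α * (b ^ (2 * n + 1) * b ^ t * (((2 * n).factorial : ℝ) / ∏ i ∈ range (2 * n + 1), (t + 1 + i))) +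
            β * (b ^ (2 * n + 2) * b ^ t * (((2 * n + 1).factorial : ℝ) / ∏ i ∈ range (2 * n + 2), (t + 1 + i)))) :=
  integral_polySum_mul_linear_mul_sub_rpow 4
    (fun n => (-1 : ℝ) ^ n * x ^ (2 * n + 1) / ((2 * n + 1).factorial : ℝ)) (fun n => 2 * n) α β ht hb

/-- Closed form of the inner integral of `T_A`: for `u ≤ 1`,
`∫₀^{1−u} f₀(v)f₀(u+v) v^{129/400} dv = (1 − 7u/10)(1−u)^{529/400}/(529/400)
 + (−7/5 + 49u/100)(1−u)^{929/400}/(929/400) + (49/100)(1−u)^{1329/400}/(1329/400)`.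
[claim: Inoue2026, status: under-review] -/
theorem innerA_eq {u : ℝ} (hu : u ≤ 1) :
    ∫ v in (0 : ℝ)..(1 - u), Inoue2026.f₀ v * Inoue2026.f₀ (u + v) * v ^ (129 / 400 : ℝ)
      = (1 - 7 / 10 * u) * ((1 - u) ^ (529 / 400 : ℝ) / (529 / 400)) +
        (-7 / 5 + 49 / 100 * u) * ((1 - u) ^ (929 / 400 : ℝ) / (929 / 400))
        + 49 / 100 * ((1 - u) ^ (1329 / 400 : ℝ) / (1329 / 400)) := by
  have e : (fun v : ℝ => Inoue2026.f₀ v * Inoue2026.f₀ (u + v) * v ^ (129 / 400 : ℝ))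
      = fun v => ((1 - 7 / 10 * u) + (-7 / 5 + 49 / 100 * u) * v + 49 / 100 * v ^ 2) * v ^ (129 / 400 : ℝ) := by
    ext v; rw [f₀_eq, f₀_eq]; ring
  rw [e, inner_poly_rpow (by norm_num) (by linarith)]
  norm_num

/-- The inner integral of `T_A` is `≥ 0` for `0 ≤ u ≤ 1`. [claim: Inoue2026, status: under-review] -/
theorem innerA_nonneg {u : ℝ} (hu0 : 0 ≤ u) (hu : u ≤ 1) :
    0 ≤ ∫ v in (0 : ℝ)..(1 - u), Inoue2026.f₀ v * Inoue2026.f₀ (u + v) * v ^ (129 / 400 : ℝ) :=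
  intervalIntegral.integral_nonneg (by linarith) fun v hv =>
    mul_nonneg (mul_nonneg (f₀_nonneg (by linarith [hv.2])) (f₀_nonneg (by linarith [hv.2])))
      (Real.rpow_nonneg hv.1 _)

/-- **`T_A` lower bound**: for `0 < x`, the Beta-rational minorant obtained from `sin ≥ S₇` is below
`∫₀¹ (sin(xu)/u) ∫₀^{1−u} f₀(v)f₀(u+v) v^{129/400} dv du`. [claim: Inoue2026, status: under-review] -/
theorem termA_lower {x : ℝ} (hx : 0 < x) :
    (400 / 529 * ∑ n ∈ range 4, (-1 : ℝ) ^ n * x ^ (2 * n + 1) / ((2 * n + 1).factorial : ℝ) *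
        (1 * (((2 * n).factorial : ℝ) / ∏ i ∈ range (2 * n + 1), ((529 / 400 : ℝ) + 1 + i)) +
          (-7 / 10) * (((2 * n + 1).factorial : ℝ) / ∏ i ∈ range (2 * n + 2), ((529 / 400 : ℝ) + 1 + i))) +
      400 / 929 * ∑ n ∈ range 4, (-1 : ℝ) ^ n * x ^ (2 * n + 1) / ((2 * n + 1).factorial : ℝ) *
        (-7 / 5 * (((2 * n).factorial : ℝ) / ∏ i ∈ range (2 * n + 1), ((929 / 400 : ℝ) + 1 + i)) +
          49 / 100 * (((2 * n + 1).factorial : ℝ) / ∏ i ∈ range (2 * n + 2), ((929 / 400 : ℝ) + 1 + i))) +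
      400 / 1329 * ∑ n ∈ range 4, (-1 : ℝ) ^ n * x ^ (2 * n + 1) / ((2 * n + 1).factorial : ℝ) *
        (49 / 100 * (((2 * n).factorial : ℝ) / ∏ i ∈ range (2 * n + 1), ((1329 / 400 : ℝ) + 1 + i)) +
          0 * (((2 * n + 1).factorial : ℝ) / ∏ i ∈ range (2 * n + 2), ((1329 / 400 : ℝ) + 1 + i))))
      ≤ ∫ u in (0 : ℝ)..1, Real.sin (x * u) / u *
          ∫ v in (0 : ℝ)..(1 - u), Inoue2026.f₀ v * Inoue2026.f₀ (u + v) * v ^ (129 / 400 : ℝ) := by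
  set p : ℝ → ℝ := fun u => ∑ n ∈ range 4, (-1 : ℝ) ^ n * x ^ (2 * n + 1) / ((2 * n + 1).factorial : ℝ) *
    u ^ (2 * n) with hp
  set A : ℝ → ℝ := fun u => (1 - 7 / 10 * u) * ((1 - u) ^ (529 / 400 : ℝ) / (529 / 400)) +
    (-7 / 5 + 49 / 100 * u) * ((1 - u) ^ (929 / 400 : ℝ) / (929 / 400))
    + 49 / 100 * ((1 - u) ^ (1329 / 400 : ℝ) / (1329 / 400)) with hA
  -- Step 1: closed form of the inner integral on `[0,1]`
  have hcongr : ∫ u in (0 : ℝ)..1, Real.sin (x * u) / u *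
        ∫ v in (0 : ℝ)..(1 - u), Inoue2026.f₀ v * Inoue2026.f₀ (u + v) * v ^ (129 / 400 : ℝ)
      = ∫ u in (0 : ℝ)..1, Real.sin (x * u) / u * A u := by
    refine intervalIntegral.integral_congr fun u hu => ?_
    rw [Set.uIcc_of_le zero_le_one] at hu
    simp only [hA]
    rw [innerA_eq hu.2]
  rw [hcongr]
  -- continuity facts
  have h1c : Continuous fun u : ℝ => (1 - u) ^ (529 / 400 : ℝ) := continuous_sub_rpow 1 (by norm_num)
  have h2c : Continuous fun u : ℝ => (1 - u) ^ (929 / 400 : ℝ) := continuous_sub_rpow 1 (by norm_num)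
  have h3c : Continuous fun u : ℝ => (1 - u) ^ (1329 / 400 : ℝ) := continuous_sub_rpow 1 (by norm_num)
  have hpc : Continuous p := by simp only [hp]; fun_prop
  have hAc : Continuous A := by
    simp only [hA]
    exact ((((by fun_prop : Continuous fun u : ℝ => 1 - 7 / 10 * u).mul (h1c.div_const _)).add
      ((by fun_prop : Continuous fun u : ℝ => -7 / 5 + 49 / 100 * u).mul (h2c.div_const _))).add
      (continuous_const.mul (h3c.div_const _)))
  -- Step 2: split `p · A` into the three generic pieces
  have heval : ∫ u in (0 : ℝ)..1, p u * A u
      = 400 / 529 * (∫ u in (0 : ℝ)..1, p u * ((1 + (-7 / 10) * u) * (1 - u) ^ (529 / 400 : ℝ))) +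
        400 / 929 * (∫ u in (0 : ℝ)..1, p u * ((-7 / 5 + 49 / 100 * u) * (1 - u) ^ (929 / 400 : ℝ))) +
        400 / 1329 * (∫ u in (0 : ℝ)..1, p u * ((49 / 100 + 0 * u) * (1 - u) ^ (1329 / 400 : ℝ))) := by
    have e : ∀ u, p u * A u = 400 / 529 * (p u * ((1 + (-7 / 10) * u) * (1 - u) ^ (529 / 400 : ℝ))) +
        400 / 929 * (p u * ((-7 / 5 + 49 / 100 * u) * (1 - u) ^ (929 / 400 : ℝ))) +
        400 / 1329 * (p u * ((49 / 100 + 0 * u) * (1 - u) ^ (1329 / 400 : ℝ))) := by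
      intro u; simp only [hA]; ring
    simp_rw [e]
    have i1 : IntervalIntegrable (fun u => 400 / 529 * (p u * ((1 + (-7 / 10) * u) * (1 - u) ^ (529 / 400 : ℝ))))
        volume 0 1 :=
      ((hpc.mul ((continuous_const.add (continuous_const.mul continuous_id)).mul h1c)).const_mul _
        ).intervalIntegrable _ _
    have i2 : IntervalIntegrable (fun u => 400 / 929 * (p u * ((-7 / 5 + 49 / 100 * u) * (1 - u) ^ (929 / 400 : ℝ))))
        volume 0 1 :=
      ((hpc.mul ((continuous_const.add (continuous_const.mul continuous_id)).mul h2c)).const_mul _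
        ).intervalIntegrable _ _
    have i3 : IntervalIntegrable (fun u => 400 / 1329 * (p u * ((49 / 100 + 0 * u) * (1 - u) ^ (1329 / 400 : ℝ))))
        volume 0 1 :=
      ((hpc.mul ((continuous_const.add (continuous_const.mul continuous_id)).mul h3c)).const_mul _
        ).intervalIntegrable _ _
    rw [intervalIntegral.integral_add (i1.add i2) i3, intervalIntegral.integral_add i1 i2,
      intervalIntegral.integral_const_mul, intervalIntegral.integral_const_mul,
      intervalIntegral.integral_const_mul]
  -- Step 3: integrability of the true integrand and comparison on `(0,1)`
  have hgc : Continuous (fun u : ℝ => x * Real.sinc (x * u) * A u) :=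
    (continuous_const.mul (Real.continuous_sinc.comp (continuous_const.mul continuous_id))).mul hAc
  have hfg : EqOn (fun u : ℝ => x * Real.sinc (x * u) * A u)
      (fun u => Real.sin (x * u) / u * A u) (Ι (0 : ℝ) 1) := by
    intro u hu
    rw [Set.uIoc_of_le zero_le_one] at hu
    have hu0 : u ≠ 0 := hu.1.ne'
    simp only
    rw [Real.sinc_of_ne_zero (mul_ne_zero hx.ne' hu0)]
    field_simp
  have hfi : IntervalIntegrable (fun u => Real.sin (x * u) / u * A u) volume 0 1 :=
    (hgc.intervalIntegrable 0 1).congr hfg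
  have hlow : ∫ u in (0 : ℝ)..1, p u * A u ≤ ∫ u in (0 : ℝ)..1, Real.sin (x * u) / u * A u := by
    refine intervalIntegral.integral_mono_on_of_le_Ioo zero_le_one ((hpc.mul hAc).intervalIntegrable _ _) hfi
      fun u hu => ?_
    have hAu : 0 ≤ A u := by
      simp only [hA]; rw [← innerA_eq hu.2.le]; exact innerA_nonneg hu.1.le hu.2.le
    exact mul_le_mul_of_nonneg_right (polyS_le_sin_div hx.le hu.1) hAu
  refine le_trans (le_of_eq ?_) hlow
  have hE : ∀ (α β t : ℝ), 0 < t →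
      ∫ u in (0 : ℝ)..1, p u * ((α + β * u) * (1 - u) ^ t)
        = ∑ n ∈ range 4, (-1 : ℝ) ^ n * x ^ (2 * n + 1) / ((2 * n + 1).factorial : ℝ) *
          (α * (((2 * n).factorial : ℝ) / ∏ i ∈ range (2 * n + 1), (t + 1 + i)) +
            β * (((2 * n + 1).factorial : ℝ) / ∏ i ∈ range (2 * n + 2), (t + 1 + i))) := by
    intro α β t ht
    simp only [hp]
    exact integral_polyS_lin_rpow x α β ht
  rw [heval, hE 1 (-7 / 10) (529 / 400) (by norm_num), hE (-7 / 5) (49 / 100) (929 / 400) (by norm_num),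
    hE (49 / 100) 0 (1329 / 400) (by norm_num)]

/-! ### 8. Term `T_B` (the double integral) bounded below -/

/-- `(1−u)^k (1−u)^t = (1−u)^{t+k}` for `u ≤ 1`, `t ≥ 0`. [folklore] -/
private theorem pow_mul_rpow_one_sub {u : ℝ} (hu : u ≤ 1) (k : ℕ) {t : ℝ} (ht : 0 ≤ t) :
    (1 - u) ^ k * (1 - u) ^ t = (1 - u) ^ (t + k) := by
  rw [Real.rpow_add_of_nonneg (sub_nonneg.2 hu) ht (Nat.cast_nonneg k), Real.rpow_natCast, mul_comm]

/-- **The outer evaluation**: `∫₀¹ p(u)·Σₙ aₙ[(α₀+α₁u)(1−u)^{2n+1}(1−u)^t J(2n,t) + (β₀+β₁u)(1−u)^{2n+2}(1−u)^t J(2n+1,t)] du`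
as a double Beta sum (combine the powers, then the generic lemma at exponent `t + (2n+1)`,
`t + (2n+2)`). [folklore] -/
private theorem integral_polyS_outer (x α₀ α₁ β₀ β₁ : ℝ) {t : ℝ} (ht : 0 < t) :
    ∫ u in (0 : ℝ)..1, (∑ n ∈ range 4, (-1 : ℝ) ^ n * x ^ (2 * n + 1) / ((2 * n + 1).factorial : ℝ) * u ^ (2 * n)) *
        ∑ n ∈ range 4, (-1 : ℝ) ^ n * x ^ (2 * n + 1) / ((2 * n + 1).factorial : ℝ) *
          ((α₀ + α₁ * u) * ((1 - u) ^ (2 * n + 1) * (1 - u) ^ t *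
              (((2 * n).factorial : ℝ) / ∏ i ∈ range (2 * n + 1), (t + 1 + i))) +
            (β₀ + β₁ * u) * ((1 - u) ^ (2 * n + 2) * (1 - u) ^ t *
              (((2 * n + 1).factorial : ℝ) / ∏ i ∈ range (2 * n + 2), (t + 1 + i))))
      = ∑ n ∈ range 4, (-1 : ℝ) ^ n * x ^ (2 * n + 1) / ((2 * n + 1).factorial : ℝ) *
          ((((2 * n).factorial : ℝ) / ∏ i ∈ range (2 * n + 1), (t + 1 + i)) *
              ∑ m ∈ range 4, (-1 : ℝ) ^ m * x ^ (2 * m + 1) / ((2 * m + 1).factorial : ℝ) *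
                (α₀ * (((2 * m).factorial : ℝ) / ∏ i ∈ range (2 * m + 1), (t + ((2 * n + 1 : ℕ) : ℝ) + 1 + i)) +
                  α₁ * (((2 * m + 1).factorial : ℝ) / ∏ i ∈ range (2 * m + 2), (t + ((2 * n + 1 : ℕ) : ℝ) + 1 + i))) +
            (((2 * n + 1).factorial : ℝ) / ∏ i ∈ range (2 * n + 2), (t + 1 + i)) *
              ∑ m ∈ range 4, (-1 : ℝ) ^ m * x ^ (2 * m + 1) / ((2 * m + 1).factorial : ℝ) *
                (β₀ * (((2 * m).factorial : ℝ) / ∏ i ∈ range (2 * m + 1), (t + ((2 * n + 2 : ℕ) : ℝ) + 1 + i)) +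
                  β₁ * (((2 * m + 1).factorial : ℝ) / ∏ i ∈ range (2 * m + 2), (t + ((2 * n + 2 : ℕ) : ℝ) + 1 + i)))) := by
  set p : ℝ → ℝ := fun u => ∑ n ∈ range 4, (-1 : ℝ) ^ n * x ^ (2 * n + 1) / ((2 * n + 1).factorial : ℝ) *
    u ^ (2 * n) with hp
  have hpc : Continuous p := by simp only [hp]; fun_prop
  -- abbreviations for the constants
  set a : ℕ → ℝ := fun n => (-1 : ℝ) ^ n * x ^ (2 * n + 1) / ((2 * n + 1).factorial : ℝ) with ha
  set J : ℕ → ℝ := fun n => ((2 * n).factorial : ℝ) / ∏ i ∈ range (2 * n + 1), (t + 1 + i) with hJ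
  set J' : ℕ → ℝ := fun n => ((2 * n + 1).factorial : ℝ) / ∏ i ∈ range (2 * n + 2), (t + 1 + i) with hJ'
  -- pointwise regrouping on `[0,1]`
  have e : EqOn (fun u => p u * ∑ n ∈ range 4, a n *
        ((α₀ + α₁ * u) * ((1 - u) ^ (2 * n + 1) * (1 - u) ^ t * J n) +
          (β₀ + β₁ * u) * ((1 - u) ^ (2 * n + 2) * (1 - u) ^ t * J' n)))
      (fun u => ∑ n ∈ range 4, ((a n * J n) * (p u * ((α₀ + α₁ * u) * (1 - u) ^ (t + ((2 * n + 1 : ℕ) : ℝ)))) +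
        (a n * J' n) * (p u * ((β₀ + β₁ * u) * (1 - u) ^ (t + ((2 * n + 2 : ℕ) : ℝ))))))
      (Set.uIcc (0 : ℝ) 1) := by
    intro u hu
    rw [Set.uIcc_of_le zero_le_one] at hu
    simp only
    rw [Finset.mul_sum]
    refine Finset.sum_congr rfl fun n _ => ?_
    rw [← pow_mul_rpow_one_sub hu.2 (2 * n + 1) ht.le, ← pow_mul_rpow_one_sub hu.2 (2 * n + 2) ht.le]
    ring
  have hE : ∀ (α β T : ℝ), 0 < T →
      ∫ u in (0 : ℝ)..1, p u * ((α + β * u) * (1 - u) ^ T)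
        = ∑ m ∈ range 4, (-1 : ℝ) ^ m * x ^ (2 * m + 1) / ((2 * m + 1).factorial : ℝ) *
          (α * (((2 * m).factorial : ℝ) / ∏ i ∈ range (2 * m + 1), (T + 1 + i)) +
            β * (((2 * m + 1).factorial : ℝ) / ∏ i ∈ range (2 * m + 2), (T + 1 + i))) := by
    intro α β T hT
    simp only [hp]
    exact integral_polyS_lin_rpow x α β hT
  have hi : ∀ (c α β T : ℝ), 0 ≤ T →
      IntervalIntegrable (fun u : ℝ => c * (p u * ((α + β * u) * (1 - u) ^ T))) volume 0 1 :=
    fun c α β T hT => ((hpc.mul ((continuous_const.add (continuous_const.mul continuous_id)).mul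
      (continuous_sub_rpow 1 hT))).const_mul c).intervalIntegrable _ _
  rw [intervalIntegral.integral_congr e, intervalIntegral.integral_finsetSum]
  · refine Finset.sum_congr rfl fun n _ => ?_
    have hT1 : 0 < t + ((2 * n + 1 : ℕ) : ℝ) := by positivity
    have hT2 : 0 < t + ((2 * n + 2 : ℕ) : ℝ) := by positivity
    rw [intervalIntegral.integral_add (hi _ _ _ _ hT1.le) (hi _ _ _ _ hT2.le),
      intervalIntegral.integral_const_mul, intervalIntegral.integral_const_mul, hE _ _ _ hT1, hE _ _ _ hT2]
    simp only [ha, hJ, hJ']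
    ring
  · intro n _
    exact (hi _ _ _ _ (by positivity)).add (hi _ _ _ _ (by positivity))

/-- Closed form of the innermost integral of `T_B`: for `u₁ + u₂ ≤ 1`,
`∫₀^{1−(u₁+u₂)} (f₀(v)f₀(u₁+u₂+v) + f₀(u₁+v)f₀(u₂+v)) v^{129/400} dv
 = (2 − (7/5)(u₁+u₂) + (49/100)u₁u₂)(1−u₁−u₂)^{529/400}/(529/400)
 + (−14/5 + (49/50)(u₁+u₂))(1−u₁−u₂)^{929/400}/(929/400) + (49/50)(1−u₁−u₂)^{1329/400}/(1329/400)`.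
[claim: Inoue2026, status: under-review] -/
theorem innerB_eq {u₁ u₂ : ℝ} (h : u₁ + u₂ ≤ 1) :
    ∫ v in (0 : ℝ)..(1 - (u₁ + u₂)),
        (Inoue2026.f₀ v * Inoue2026.f₀ (u₁ + u₂ + v) + Inoue2026.f₀ (u₁ + v) * Inoue2026.f₀ (u₂ + v)) *
          v ^ (129 / 400 : ℝ)
      = (2 - 7 / 5 * (u₁ + u₂) + 49 / 100 * (u₁ * u₂)) * ((1 - (u₁ + u₂)) ^ ((129 / 400 : ℝ) + 1) / (129 / 400 + 1)) +
        (-14 / 5 + 49 / 50 * (u₁ + u₂)) * ((1 - (u₁ + u₂)) ^ ((129 / 400 : ℝ) + 2) / (129 / 400 + 2)) +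
        49 / 50 * ((1 - (u₁ + u₂)) ^ ((129 / 400 : ℝ) + 3) / (129 / 400 + 3)) := by
  have e : (fun v : ℝ => (Inoue2026.f₀ v * Inoue2026.f₀ (u₁ + u₂ + v) +
        Inoue2026.f₀ (u₁ + v) * Inoue2026.f₀ (u₂ + v)) * v ^ (129 / 400 : ℝ))
      = fun v => ((2 - 7 / 5 * (u₁ + u₂) + 49 / 100 * (u₁ * u₂)) + (-14 / 5 + 49 / 50 * (u₁ + u₂)) * v +
          49 / 50 * v ^ 2) * v ^ (129 / 400 : ℝ) := by
    ext v; rw [f₀_eq, f₀_eq, f₀_eq, f₀_eq]; ring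
  rw [e, inner_poly_rpow (by norm_num) (by linarith)]

/-- The innermost integral of `T_B` is `≥ 0` for `u₁, u₂ ≥ 0`, `u₁ + u₂ ≤ 1`.
[claim: Inoue2026, status: under-review] -/
theorem innerB_nonneg {u₁ u₂ : ℝ} (h₁ : 0 ≤ u₁) (h₂ : 0 ≤ u₂) (h : u₁ + u₂ ≤ 1) :
    0 ≤ ∫ v in (0 : ℝ)..(1 - (u₁ + u₂)),
        (Inoue2026.f₀ v * Inoue2026.f₀ (u₁ + u₂ + v) + Inoue2026.f₀ (u₁ + v) * Inoue2026.f₀ (u₂ + v)) *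
          v ^ (129 / 400 : ℝ) :=
  intervalIntegral.integral_nonneg (by linarith) fun v hv =>
    mul_nonneg (add_nonneg (mul_nonneg (f₀_nonneg (by linarith [hv.2])) (f₀_nonneg (by linarith [hv.2])))
      (mul_nonneg (f₀_nonneg (by linarith [hv.2])) (f₀_nonneg (by linarith [hv.2]))))
      (Real.rpow_nonneg hv.1 _)

/-- **`T_B` lower bound**: for `0 < x ≤ 2`, the double Beta sum obtained from `sin ≥ S₇ ≥ 0` (both
`sin` factors replaced, the inner integral scaled by `u₂ = (1−u₁)y`) is below the typed double integral.
[claim: Inoue2026, status: under-review] -/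
theorem termB_lower {x : ℝ} (hx : 0 < x) (hx2 : x ≤ 2) :
    (∑ n ∈ range 4, (-1 : ℝ) ^ n * x ^ (2 * n + 1) / ((2 * n + 1).factorial : ℝ) *
        (400 / 529 * ((((2 * n).factorial : ℝ) / ∏ i ∈ range (2 * n + 1), ((529 / 400 : ℝ) + 1 + i)) *
              ∑ m ∈ range 4, (-1 : ℝ) ^ m * x ^ (2 * m + 1) / ((2 * m + 1).factorial : ℝ) *
                (2 * (((2 * m).factorial : ℝ) / ∏ i ∈ range (2 * m + 1), ((529 / 400 : ℝ) + ((2 * n + 1 : ℕ) : ℝ) + 1 + i)) +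
                  (-7 / 5) * (((2 * m + 1).factorial : ℝ) / ∏ i ∈ range (2 * m + 2), ((529 / 400 : ℝ) + ((2 * n + 1 : ℕ) : ℝ) + 1 + i))) +
            (((2 * n + 1).factorial : ℝ) / ∏ i ∈ range (2 * n + 2), ((529 / 400 : ℝ) + 1 + i)) *
              ∑ m ∈ range 4, (-1 : ℝ) ^ m * x ^ (2 * m + 1) / ((2 * m + 1).factorial : ℝ) *
                ((-7 / 5) * (((2 * m).factorial : ℝ) / ∏ i ∈ range (2 * m + 1), ((529 / 400 : ℝ) + ((2 * n + 2 : ℕ) : ℝ) + 1 + i)) +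
                  49 / 100 * (((2 * m + 1).factorial : ℝ) / ∏ i ∈ range (2 * m + 2), ((529 / 400 : ℝ) + ((2 * n + 2 : ℕ) : ℝ) + 1 + i)))) +
        400 / 929 * ((((2 * n).factorial : ℝ) / ∏ i ∈ range (2 * n + 1), ((929 / 400 : ℝ) + 1 + i)) *
              ∑ m ∈ range 4, (-1 : ℝ) ^ m * x ^ (2 * m + 1) / ((2 * m + 1).factorial : ℝ) *
                ((-14 / 5) * (((2 * m).factorial : ℝ) / ∏ i ∈ range (2 * m + 1), ((929 / 400 : ℝ) + ((2 * n + 1 : ℕ) : ℝ) + 1 + i)) +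
                  49 / 50 * (((2 * m + 1).factorial : ℝ) / ∏ i ∈ range (2 * m + 2), ((929 / 400 : ℝ) + ((2 * n + 1 : ℕ) : ℝ) + 1 + i))) +
            (((2 * n + 1).factorial : ℝ) / ∏ i ∈ range (2 * n + 2), ((929 / 400 : ℝ) + 1 + i)) *
              ∑ m ∈ range 4, (-1 : ℝ) ^ m * x ^ (2 * m + 1) / ((2 * m + 1).factorial : ℝ) *
                (49 / 50 * (((2 * m).factorial : ℝ) / ∏ i ∈ range (2 * m + 1), ((929 / 400 : ℝ) + ((2 * n + 2 : ℕ) : ℝ) + 1 + i)) +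
                  0 * (((2 * m + 1).factorial : ℝ) / ∏ i ∈ range (2 * m + 2), ((929 / 400 : ℝ) + ((2 * n + 2 : ℕ) : ℝ) + 1 + i)))) +
        400 / 1329 * ((((2 * n).factorial : ℝ) / ∏ i ∈ range (2 * n + 1), ((1329 / 400 : ℝ) + 1 + i)) *
              ∑ m ∈ range 4, (-1 : ℝ) ^ m * x ^ (2 * m + 1) / ((2 * m + 1).factorial : ℝ) *
                (49 / 50 * (((2 * m).factorial : ℝ) / ∏ i ∈ range (2 * m + 1), ((1329 / 400 : ℝ) + ((2 * n + 1 : ℕ) : ℝ) + 1 + i)) +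
                  0 * (((2 * m + 1).factorial : ℝ) / ∏ i ∈ range (2 * m + 2), ((1329 / 400 : ℝ) + ((2 * n + 1 : ℕ) : ℝ) + 1 + i))) +
            (((2 * n + 1).factorial : ℝ) / ∏ i ∈ range (2 * n + 2), ((1329 / 400 : ℝ) + 1 + i)) *
              ∑ m ∈ range 4, (-1 : ℝ) ^ m * x ^ (2 * m + 1) / ((2 * m + 1).factorial : ℝ) *
                (0 * (((2 * m).factorial : ℝ) / ∏ i ∈ range (2 * m + 1), ((1329 / 400 : ℝ) + ((2 * n + 2 : ℕ) : ℝ) + 1 + i)) +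
                  0 * (((2 * m + 1).factorial : ℝ) / ∏ i ∈ range (2 * m + 2), ((1329 / 400 : ℝ) + ((2 * n + 2 : ℕ) : ℝ) + 1 + i))))))
      ≤ ∫ u₁ in (0 : ℝ)..1, Real.sin (x * u₁) / u₁ *
          ∫ u₂ in (0 : ℝ)..(1 - u₁), Real.sin (x * u₂) / u₂ *
            ∫ v in (0 : ℝ)..(1 - (u₁ + u₂)),
              (Inoue2026.f₀ v * Inoue2026.f₀ (u₁ + u₂ + v) + Inoue2026.f₀ (u₁ + v) * Inoue2026.f₀ (u₂ + v)) *
                v ^ (129 / 400 : ℝ) := by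
  set p : ℝ → ℝ := fun u => ∑ n ∈ range 4, (-1 : ℝ) ^ n * x ^ (2 * n + 1) / ((2 * n + 1).factorial : ℝ) *
    u ^ (2 * n) with hp
  set Bc : ℝ → ℝ → ℝ := fun u₁ u₂ =>
    (2 - 7 / 5 * (u₁ + u₂) + 49 / 100 * (u₁ * u₂)) * ((1 - u₁ - u₂) ^ (529 / 400 : ℝ) / (529 / 400)) +
      (-14 / 5 + 49 / 50 * (u₁ + u₂)) * ((1 - u₁ - u₂) ^ (929 / 400 : ℝ) / (929 / 400)) +
      49 / 50 * ((1 - u₁ - u₂) ^ (1329 / 400 : ℝ) / (1329 / 400)) with hBc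
  have hBc_eq : ∀ u₁ u₂ : ℝ, u₁ + u₂ ≤ 1 →
      ∫ v in (0 : ℝ)..(1 - (u₁ + u₂)),
        (Inoue2026.f₀ v * Inoue2026.f₀ (u₁ + u₂ + v) + Inoue2026.f₀ (u₁ + v) * Inoue2026.f₀ (u₂ + v)) *
          v ^ (129 / 400 : ℝ) = Bc u₁ u₂ := by
    intro u₁ u₂ h
    rw [innerB_eq h]
    simp only [hBc]
    rw [show (1 : ℝ) - (u₁ + u₂) = 1 - u₁ - u₂ by ring]
    norm_num
  -- Step 1: closed form of the innermost integral (valid for `u₁ ∈ [0,1]`, `u₂ ∈ [0, 1−u₁]`)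
  have hcongr : (∫ u₁ in (0 : ℝ)..1, Real.sin (x * u₁) / u₁ *
        ∫ u₂ in (0 : ℝ)..(1 - u₁), Real.sin (x * u₂) / u₂ *
          ∫ v in (0 : ℝ)..(1 - (u₁ + u₂)),
            (Inoue2026.f₀ v * Inoue2026.f₀ (u₁ + u₂ + v) + Inoue2026.f₀ (u₁ + v) * Inoue2026.f₀ (u₂ + v)) *
              v ^ (129 / 400 : ℝ))
      = ∫ u₁ in (0 : ℝ)..1, Real.sin (x * u₁) / u₁ *
          ∫ u₂ in (0 : ℝ)..(1 - u₁), Real.sin (x * u₂) / u₂ * Bc u₁ u₂ := by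
    refine intervalIntegral.integral_congr fun u₁ hu₁ => ?_
    rw [Set.uIcc_of_le zero_le_one] at hu₁
    congr 1
    refine intervalIntegral.integral_congr fun u₂ hu₂ => ?_
    rw [Set.uIcc_of_le (by linarith [hu₁.2] : (0 : ℝ) ≤ 1 - u₁)] at hu₂
    rw [hBc_eq u₁ u₂ (by linarith [hu₂.2])]
  rw [hcongr]
  -- continuity facts
  have hpc : Continuous p := by simp only [hp]; fun_prop
  have hBc2 : Continuous (fun q : ℝ × ℝ => Bc q.1 q.2) := by
    have hr : ∀ t : ℝ, 0 ≤ t → Continuous fun q : ℝ × ℝ => (1 - q.1 - q.2) ^ t := fun t ht =>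
      ((continuous_const.sub continuous_fst).sub continuous_snd).rpow_const fun _ => Or.inr ht
    have h1 := hr (529 / 400) (by norm_num)
    have h2 := hr (929 / 400) (by norm_num)
    have h3 := hr (1329 / 400) (by norm_num)
    simp only [hBc]
    exact ((((by fun_prop : Continuous fun q : ℝ × ℝ => 2 - 7 / 5 * (q.1 + q.2) + 49 / 100 * (q.1 * q.2)).mul
      (h1.div_const _)).add ((by fun_prop : Continuous fun q : ℝ × ℝ => -14 / 5 + 49 / 50 * (q.1 + q.2)).mul
      (h2.div_const _))).add (continuous_const.mul (h3.div_const _)))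
  have hBc1 : ∀ u₁ : ℝ, Continuous fun u₂ : ℝ => Bc u₁ u₂ := fun u₁ =>
    hBc2.comp (continuous_const.prodMk continuous_id)
  have hsincc : Continuous fun u : ℝ => x * Real.sinc (x * u) :=
    continuous_const.mul (Real.continuous_sinc.comp (continuous_const.mul continuous_id))
  -- the two parametric inner integrals are continuous in `u₁`
  have hIc : Continuous fun u₁ : ℝ => ∫ u₂ in (0 : ℝ)..(1 - u₁), x * Real.sinc (x * u₂) * Bc u₁ u₂ := by
    have hG : Continuous (Function.uncurry fun (u₁ u₂ : ℝ) => x * Real.sinc (x * u₂) * Bc u₁ u₂) :=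
      (continuous_const.mul (Real.continuous_sinc.comp (continuous_const.mul continuous_snd))).mul hBc2
    exact (intervalIntegral.continuous_parametric_primitive_of_continuous (a₀ := (0 : ℝ)) hG).comp
      (continuous_id.prodMk (continuous_const.sub continuous_id))
  have hI'c : Continuous fun u₁ : ℝ => ∫ u₂ in (0 : ℝ)..(1 - u₁), p u₂ * Bc u₁ u₂ := by
    have hG : Continuous (Function.uncurry fun (u₁ u₂ : ℝ) => p u₂ * Bc u₁ u₂) :=
      (hpc.comp continuous_snd).mul hBc2
    exact (intervalIntegral.continuous_parametric_primitive_of_continuous (a₀ := (0 : ℝ)) hG).comp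
      (continuous_id.prodMk (continuous_const.sub continuous_id))
  -- Step 2: the lower bound by monotone replacement (both `sin` factors; signs of both factors proved)
  have hlow : ∫ u₁ in (0 : ℝ)..1, p u₁ * ∫ u₂ in (0 : ℝ)..(1 - u₁), p u₂ * Bc u₁ u₂
      ≤ ∫ u₁ in (0 : ℝ)..1, Real.sin (x * u₁) / u₁ *
          ∫ u₂ in (0 : ℝ)..(1 - u₁), Real.sin (x * u₂) / u₂ * Bc u₁ u₂ := by
    refine intervalIntegral.integral_mono_on_of_le_Ioo zero_le_one ((hpc.mul hI'c).intervalIntegrable _ _)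
      ?_ fun u₁ hu₁ => ?_
    · refine ((hsincc.mul hIc).intervalIntegrable 0 1).congr fun u₁ hu₁ => ?_
      rw [Set.uIoc_of_le zero_le_one] at hu₁
      have hu0 : u₁ ≠ 0 := hu₁.1.ne'
      have hinner : ∫ u₂ in (0 : ℝ)..(1 - u₁), x * Real.sinc (x * u₂) * Bc u₁ u₂
          = ∫ u₂ in (0 : ℝ)..(1 - u₁), Real.sin (x * u₂) / u₂ * Bc u₁ u₂ := by
        refine intervalIntegral.integral_congr_ae (ae_of_all _ fun u₂ hu₂ => ?_)
        rw [Set.uIoc_of_le (by linarith [hu₁.2] : (0 : ℝ) ≤ 1 - u₁)] at hu₂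
        rw [Real.sinc_of_ne_zero (mul_ne_zero hx.ne' hu₂.1.ne')]
        field_simp
      simp only [Pi.mul_apply]
      rw [hinner, Real.sinc_of_ne_zero (mul_ne_zero hx.ne' hu0)]
      field_simp
    · obtain ⟨h0, h1⟩ := hu₁
      have hb : (0 : ℝ) ≤ 1 - u₁ := by linarith
      have hBnn : ∀ u₂ ∈ Set.Icc (0 : ℝ) (1 - u₁), 0 ≤ Bc u₁ u₂ := fun u₂ hu₂ => by
        rw [← hBc_eq u₁ u₂ (by linarith [hu₂.2])]
        exact innerB_nonneg h0.le hu₂.1 (by linarith [hu₂.2])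
      have hI'nn : 0 ≤ ∫ u₂ in (0 : ℝ)..(1 - u₁), p u₂ * Bc u₁ u₂ :=
        intervalIntegral.integral_nonneg hb fun u₂ hu₂ =>
          mul_nonneg (polyS_nonneg hx.le hx2 hu₂.1 (by linarith [hu₂.2])) (hBnn u₂ hu₂)
      have hII : ∫ u₂ in (0 : ℝ)..(1 - u₁), p u₂ * Bc u₁ u₂
          ≤ ∫ u₂ in (0 : ℝ)..(1 - u₁), Real.sin (x * u₂) / u₂ * Bc u₁ u₂ := by
        refine intervalIntegral.integral_mono_on_of_le_Ioo hb ((hpc.mul (hBc1 u₁)).intervalIntegrable _ _)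
          ?_ fun u₂ hu₂ => ?_
        · refine (((hsincc.mul (hBc1 u₁))).intervalIntegrable _ _).congr fun u₂ hu₂ => ?_
          rw [Set.uIoc_of_le hb] at hu₂
          simp only [Pi.mul_apply]
          rw [Real.sinc_of_ne_zero (mul_ne_zero hx.ne' hu₂.1.ne')]
          field_simp
        · exact mul_le_mul_of_nonneg_right (polyS_le_sin_div hx.le hu₂.1) (hBnn u₂ ⟨hu₂.1.le, hu₂.2.le⟩)
      have hsin : p u₁ ≤ Real.sin (x * u₁) / u₁ := polyS_le_sin_div hx.le h0
      have hpnn : 0 ≤ p u₁ := polyS_nonneg hx.le hx2 h0.le h1.le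
      exact mul_le_mul hsin hII hI'nn (hpnn.trans hsin)
  refine le_trans (le_of_eq ?_) hlow
  -- Step 3a: the inner minorant integral in closed form, for `u₁ ∈ [0,1]`
  have hS : ∀ (α β t : ℝ), 0 < t → ∀ {b : ℝ}, 0 ≤ b →
      ∫ u in (0 : ℝ)..b, p u * ((α + β * u) * (b - u) ^ t)
        = ∑ n ∈ range 4, (-1 : ℝ) ^ n * x ^ (2 * n + 1) / ((2 * n + 1).factorial : ℝ) *
          (α * (b ^ (2 * n + 1) * b ^ t * (((2 * n).factorial : ℝ) / ∏ i ∈ range (2 * n + 1), (t + 1 + i))) +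
            β * (b ^ (2 * n + 2) * b ^ t * (((2 * n + 1).factorial : ℝ) / ∏ i ∈ range (2 * n + 2), (t + 1 + i)))) := by
    intro α β t ht b hb
    simp only [hp]
    exact integral_polyS_lin_sub_rpow x α β ht hb
  have hinner : ∀ u₁ ∈ Set.Icc (0 : ℝ) 1, ∫ u₂ in (0 : ℝ)..(1 - u₁), p u₂ * Bc u₁ u₂
      = 400 / 529 * ∑ n ∈ range 4, (-1 : ℝ) ^ n * x ^ (2 * n + 1) / ((2 * n + 1).factorial : ℝ) *
          ((2 + (-7 / 5) * u₁) * ((1 - u₁) ^ (2 * n + 1) * (1 - u₁) ^ (529 / 400 : ℝ) *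
              (((2 * n).factorial : ℝ) / ∏ i ∈ range (2 * n + 1), ((529 / 400 : ℝ) + 1 + i))) +
            (-7 / 5 + 49 / 100 * u₁) * ((1 - u₁) ^ (2 * n + 2) * (1 - u₁) ^ (529 / 400 : ℝ) *
              (((2 * n + 1).factorial : ℝ) / ∏ i ∈ range (2 * n + 2), ((529 / 400 : ℝ) + 1 + i)))) +
        400 / 929 * ∑ n ∈ range 4, (-1 : ℝ) ^ n * x ^ (2 * n + 1) / ((2 * n + 1).factorial : ℝ) *
          ((-14 / 5 + 49 / 50 * u₁) * ((1 - u₁) ^ (2 * n + 1) * (1 - u₁) ^ (929 / 400 : ℝ) *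
              (((2 * n).factorial : ℝ) / ∏ i ∈ range (2 * n + 1), ((929 / 400 : ℝ) + 1 + i))) +
            (49 / 50 + 0 * u₁) * ((1 - u₁) ^ (2 * n + 2) * (1 - u₁) ^ (929 / 400 : ℝ) *
              (((2 * n + 1).factorial : ℝ) / ∏ i ∈ range (2 * n + 2), ((929 / 400 : ℝ) + 1 + i)))) +
        400 / 1329 * ∑ n ∈ range 4, (-1 : ℝ) ^ n * x ^ (2 * n + 1) / ((2 * n + 1).factorial : ℝ) *
          ((49 / 50 + 0 * u₁) * ((1 - u₁) ^ (2 * n + 1) * (1 - u₁) ^ (1329 / 400 : ℝ) *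
              (((2 * n).factorial : ℝ) / ∏ i ∈ range (2 * n + 1), ((1329 / 400 : ℝ) + 1 + i))) +
            (0 + 0 * u₁) * ((1 - u₁) ^ (2 * n + 2) * (1 - u₁) ^ (1329 / 400 : ℝ) *
              (((2 * n + 1).factorial : ℝ) / ∏ i ∈ range (2 * n + 2), ((1329 / 400 : ℝ) + 1 + i)))) := by
    intro u₁ hu₁
    have hb : (0 : ℝ) ≤ 1 - u₁ := by linarith [hu₁.2]
    have e : ∀ u₂, p u₂ * Bc u₁ u₂
        = 400 / 529 * (p u₂ * (((2 + (-7 / 5) * u₁) + (-7 / 5 + 49 / 100 * u₁) * u₂) * (1 - u₁ - u₂) ^ (529 / 400 : ℝ))) +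
          400 / 929 * (p u₂ * (((-14 / 5 + 49 / 50 * u₁) + (49 / 50 + 0 * u₁) * u₂) * (1 - u₁ - u₂) ^ (929 / 400 : ℝ))) +
          400 / 1329 * (p u₂ * (((49 / 50 + 0 * u₁) + (0 + 0 * u₁) * u₂) * (1 - u₁ - u₂) ^ (1329 / 400 : ℝ))) := by
      intro u₂; simp only [hBc]; ring
    simp_rw [e]
    have hi : ∀ (c α β t : ℝ), 0 ≤ t →
        IntervalIntegrable (fun u₂ : ℝ => c * (p u₂ * ((α + β * u₂) * (1 - u₁ - u₂) ^ t))) volume 0 (1 - u₁) :=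
      fun c α β t ht => ((hpc.mul ((continuous_const.add (continuous_const.mul continuous_id)).mul
        (continuous_sub_rpow (1 - u₁) ht))).const_mul c).intervalIntegrable _ _
    rw [intervalIntegral.integral_add ((hi _ _ _ _ (by norm_num)).add (hi _ _ _ _ (by norm_num)))
        (hi _ _ _ _ (by norm_num)),
      intervalIntegral.integral_add (hi _ _ _ _ (by norm_num)) (hi _ _ _ _ (by norm_num)),
      intervalIntegral.integral_const_mul, intervalIntegral.integral_const_mul,
      intervalIntegral.integral_const_mul,
      hS _ _ (529 / 400) (by norm_num) hb, hS _ _ (929 / 400) (by norm_num) hb,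
      hS _ _ (1329 / 400) (by norm_num) hb]
  -- Step 3b: the outer integral
  have hO : ∀ (α₀ α₁ β₀ β₁ t : ℝ), 0 < t →
      ∫ u in (0 : ℝ)..1, p u * ∑ n ∈ range 4, (-1 : ℝ) ^ n * x ^ (2 * n + 1) / ((2 * n + 1).factorial : ℝ) *
          ((α₀ + α₁ * u) * ((1 - u) ^ (2 * n + 1) * (1 - u) ^ t *
              (((2 * n).factorial : ℝ) / ∏ i ∈ range (2 * n + 1), (t + 1 + i))) +
            (β₀ + β₁ * u) * ((1 - u) ^ (2 * n + 2) * (1 - u) ^ t *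
              (((2 * n + 1).factorial : ℝ) / ∏ i ∈ range (2 * n + 2), (t + 1 + i))))
        = ∑ n ∈ range 4, (-1 : ℝ) ^ n * x ^ (2 * n + 1) / ((2 * n + 1).factorial : ℝ) *
          ((((2 * n).factorial : ℝ) / ∏ i ∈ range (2 * n + 1), (t + 1 + i)) *
              ∑ m ∈ range 4, (-1 : ℝ) ^ m * x ^ (2 * m + 1) / ((2 * m + 1).factorial : ℝ) *
                (α₀ * (((2 * m).factorial : ℝ) / ∏ i ∈ range (2 * m + 1), (t + ((2 * n + 1 : ℕ) : ℝ) + 1 + i)) +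
                  α₁ * (((2 * m + 1).factorial : ℝ) / ∏ i ∈ range (2 * m + 2), (t + ((2 * n + 1 : ℕ) : ℝ) + 1 + i))) +
            (((2 * n + 1).factorial : ℝ) / ∏ i ∈ range (2 * n + 2), (t + 1 + i)) *
              ∑ m ∈ range 4, (-1 : ℝ) ^ m * x ^ (2 * m + 1) / ((2 * m + 1).factorial : ℝ) *
                (β₀ * (((2 * m).factorial : ℝ) / ∏ i ∈ range (2 * m + 1), (t + ((2 * n + 2 : ℕ) : ℝ) + 1 + i)) +
                  β₁ * (((2 * m + 1).factorial : ℝ) / ∏ i ∈ range (2 * m + 2), (t + ((2 * n + 2 : ℕ) : ℝ) + 1 + i)))) := by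
    intro α₀ α₁ β₀ β₁ t ht
    simp only [hp]
    exact integral_polyS_outer x α₀ α₁ β₀ β₁ ht
  have hcongr2 : ∫ u₁ in (0 : ℝ)..1, p u₁ * ∫ u₂ in (0 : ℝ)..(1 - u₁), p u₂ * Bc u₁ u₂
      = ∫ u₁ in (0 : ℝ)..1, (400 / 529 * (p u₁ * ∑ n ∈ range 4, (-1 : ℝ) ^ n * x ^ (2 * n + 1) / ((2 * n + 1).factorial : ℝ) *
          ((2 + (-7 / 5) * u₁) * ((1 - u₁) ^ (2 * n + 1) * (1 - u₁) ^ (529 / 400 : ℝ) *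
              (((2 * n).factorial : ℝ) / ∏ i ∈ range (2 * n + 1), ((529 / 400 : ℝ) + 1 + i))) +
            (-7 / 5 + 49 / 100 * u₁) * ((1 - u₁) ^ (2 * n + 2) * (1 - u₁) ^ (529 / 400 : ℝ) *
              (((2 * n + 1).factorial : ℝ) / ∏ i ∈ range (2 * n + 2), ((529 / 400 : ℝ) + 1 + i))))) +
        400 / 929 * (p u₁ * ∑ n ∈ range 4, (-1 : ℝ) ^ n * x ^ (2 * n + 1) / ((2 * n + 1).factorial : ℝ) *
          ((-14 / 5 + 49 / 50 * u₁) * ((1 - u₁) ^ (2 * n + 1) * (1 - u₁) ^ (929 / 400 : ℝ) *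
              (((2 * n).factorial : ℝ) / ∏ i ∈ range (2 * n + 1), ((929 / 400 : ℝ) + 1 + i))) +
            (49 / 50 + 0 * u₁) * ((1 - u₁) ^ (2 * n + 2) * (1 - u₁) ^ (929 / 400 : ℝ) *
              (((2 * n + 1).factorial : ℝ) / ∏ i ∈ range (2 * n + 2), ((929 / 400 : ℝ) + 1 + i))))) +
        400 / 1329 * (p u₁ * ∑ n ∈ range 4, (-1 : ℝ) ^ n * x ^ (2 * n + 1) / ((2 * n + 1).factorial : ℝ) *
          ((49 / 50 + 0 * u₁) * ((1 - u₁) ^ (2 * n + 1) * (1 - u₁) ^ (1329 / 400 : ℝ) *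
              (((2 * n).factorial : ℝ) / ∏ i ∈ range (2 * n + 1), ((1329 / 400 : ℝ) + 1 + i))) +
            (0 + 0 * u₁) * ((1 - u₁) ^ (2 * n + 2) * (1 - u₁) ^ (1329 / 400 : ℝ) *
              (((2 * n + 1).factorial : ℝ) / ∏ i ∈ range (2 * n + 2), ((1329 / 400 : ℝ) + 1 + i)))))) := by
    refine intervalIntegral.integral_congr fun u₁ hu₁ => ?_
    rw [Set.uIcc_of_le zero_le_one] at hu₁
    rw [hinner u₁ hu₁]
    ring
  have hpiece : ∀ (α₀ α₁ β₀ β₁ t : ℝ), 0 ≤ t → Continuous fun u : ℝ =>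
      p u * ∑ n ∈ range 4, (-1 : ℝ) ^ n * x ^ (2 * n + 1) / ((2 * n + 1).factorial : ℝ) *
          ((α₀ + α₁ * u) * ((1 - u) ^ (2 * n + 1) * (1 - u) ^ t *
              (((2 * n).factorial : ℝ) / ∏ i ∈ range (2 * n + 1), (t + 1 + i))) +
            (β₀ + β₁ * u) * ((1 - u) ^ (2 * n + 2) * (1 - u) ^ t *
              (((2 * n + 1).factorial : ℝ) / ∏ i ∈ range (2 * n + 2), (t + 1 + i)))) := by
    intro α₀ α₁ β₀ β₁ t ht
    have hr : Continuous fun u : ℝ => (1 - u) ^ t := continuous_sub_rpow 1 ht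
    refine hpc.mul (continuous_finsetSum _ fun n _ => ?_)
    exact continuous_const.mul
      ((((continuous_const.add (continuous_const.mul continuous_id))).mul
        ((((continuous_const.sub continuous_id).pow _).mul hr).mul continuous_const)).add
      (((continuous_const.add (continuous_const.mul continuous_id))).mul
        ((((continuous_const.sub continuous_id).pow _).mul hr).mul continuous_const)))
  have i1 := ((hpiece 2 (-7 / 5) (-7 / 5) (49 / 100) (529 / 400) (by norm_num)).const_mul (400 / 529 : ℝ)
    ).intervalIntegrable (μ := volume) 0 1
  have i2 := ((hpiece (-14 / 5) (49 / 50) (49 / 50) 0 (929 / 400) (by norm_num)).const_mul (400 / 929 : ℝ)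
    ).intervalIntegrable (μ := volume) 0 1
  have i3 := ((hpiece (49 / 50) 0 0 0 (1329 / 400) (by norm_num)).const_mul (400 / 1329 : ℝ)
    ).intervalIntegrable (μ := volume) 0 1
  rw [hcongr2, intervalIntegral.integral_add (i1.add i2) i3, intervalIntegral.integral_add i1 i2,
    intervalIntegral.integral_const_mul, intervalIntegral.integral_const_mul,
    intervalIntegral.integral_const_mul,
    hO 2 (-7 / 5) (-7 / 5) (49 / 100) (529 / 400) (by norm_num),
    hO (-14 / 5) (49 / 50) (49 / 50) 0 (929 / 400) (by norm_num),
    hO (49 / 50) 0 0 0 (1329 / 400) (by norm_num)]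
  rw [Finset.mul_sum, Finset.mul_sum, Finset.mul_sum, ← Finset.sum_add_distrib, ← Finset.sum_add_distrib]
  refine Finset.sum_congr rfl fun n _ => ?_
  ring

/-! ### 9. The endgame: `I_f` in closed form and the certified inequality -/

/-- `I_f(ℓ) = ∫₀¹ f₀(u)² u^{129/400} du = 400/529 − 560/929 + 196/1329` at `ℓ = 1.15`.
[claim: Inoue2026, status: under-review] -/
theorem If_f₀_eq : Inoue2026.If Inoue2026.f₀ 1.15 = 400 / 529 - 560 / 929 + 196 / 1329 := by
  unfold Inoue2026.If
  have hℓ : ((1.15 : ℝ)) ^ 2 - 1 = 129 / 400 := by norm_num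
  simp only [hℓ]
  have e : (fun u : ℝ => Inoue2026.f₀ u ^ 2 * u ^ (129 / 400 : ℝ))
      = fun u => (1 + (-7 / 5) * u + 49 / 100 * u ^ 2) * u ^ (129 / 400 : ℝ) := by
    ext u; rw [f₀_eq]; ring
  rw [e, inner_poly_rpow (by norm_num) zero_le_one]
  norm_num

set_option maxHeartbeats 800000 in
/-- **The certified inequality for the correctly parenthesised main term** (the three printed summands
of `𝓜_{ℓ,f}(φ)` at `φ = 0.508949`, `ℓ = 1.15`, `f = f₀`, each outer integral in parentheses — the
records-v4 reading of `Inoue2026.M`): `10⁻⁵ ≤ 𝓜/I_f − φ(1−φ)`.  Proof: the three term minorants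
(`termA_lower`, `termB_lower`, `termC_lower` at `x = π·0.508949 ∈ (0, 2]`), `I_f` in closed form,
multiplication by `π² I_f > 0`, expansion of the finite Beta sums by `norm_num`, and `nlinarith` on the
monomials `π^{2j}` bracketed by `Real.pi_gt_d20`/`Real.pi_lt_d20`.
[claim: Inoue2026, status: under-review] -/
theorem mainTerm_lower :
    (1 : ℝ) / 10 ^ 5 ≤
      (|1 - 2 * (0.508949 : ℝ)| * (2 / π) * 1.15 *
            (∫ u in (0 : ℝ)..1, Real.sin (π * 0.508949 * u) / u *
              ∫ v in (0 : ℝ)..(1 - u), Inoue2026.f₀ v * Inoue2026.f₀ (u + v) * v ^ ((1.15 : ℝ) ^ 2 - 1)) +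
          2 / π ^ 2 * (1.15 : ℝ) ^ 2 *
            (∫ u₁ in (0 : ℝ)..1, Real.sin (π * 0.508949 * u₁) / u₁ *
              ∫ u₂ in (0 : ℝ)..(1 - u₁), Real.sin (π * 0.508949 * u₂) / u₂ *
                ∫ v in (0 : ℝ)..(1 - (u₁ + u₂)),
                  (Inoue2026.f₀ v * Inoue2026.f₀ (u₁ + u₂ + v) + Inoue2026.f₀ (u₁ + v) * Inoue2026.f₀ (u₂ + v)) *
                    v ^ ((1.15 : ℝ) ^ 2 - 1)) +
          2 / π ^ 2 *
            (∫ u in (0 : ℝ)..1, Real.sin (π * 0.508949 * u) ^ 2 / u *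
              ∫ v in (0 : ℝ)..(1 - u), Inoue2026.f₀ v ^ 2 * v ^ ((1.15 : ℝ) ^ 2 - 1))) /
          Inoue2026.If Inoue2026.f₀ 1.15 -
        0.508949 * (1 - 0.508949) := by
  have hℓ : ((1.15 : ℝ)) ^ 2 - 1 = 129 / 400 := by norm_num
  simp only [hℓ]
  rw [If_f₀_eq]
  have hπ : 0 < π := Real.pi_pos
  have hx : 0 < π * 0.508949 := by positivity
  have hx2 : π * 0.508949 ≤ 2 := by nlinarith [Real.pi_lt_d2]
  have hA := termA_lower hx
  have hB := termB_lower hx hx2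
  have hC := termC_lower hx
  have hκA : 0 ≤ |1 - 2 * (0.508949 : ℝ)| * (2 / π) * 1.15 := by positivity
  have hκB : 0 ≤ 2 / π ^ 2 * (1.15 : ℝ) ^ 2 := by positivity
  have hκC : (0 : ℝ) ≤ 2 / π ^ 2 := by positivity
  have hI : (0 : ℝ) < 400 / 529 - 560 / 929 + 196 / 1329 := by norm_num
  have hnum := add_le_add (add_le_add (mul_le_mul_of_nonneg_left hA hκA) (mul_le_mul_of_nonneg_left hB hκB))
    (mul_le_mul_of_nonneg_left hC hκC)
  refine le_trans ?_ (sub_le_sub_right (div_le_div_of_nonneg_right hnum hI.le) _)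
  -- it remains a closed real inequality in `π` only
  have habs : |1 - 2 * (0.508949 : ℝ)| = 17898 / 1000000 := by
    rw [abs_of_neg (by norm_num)]; norm_num
  rw [habs, le_sub_iff_add_le, le_div_iff₀ hI]
  -- clear the powers of `π` in the denominators: multiply by `π²`
  rw [← mul_le_mul_iff_of_pos_left (show (0 : ℝ) < π ^ 2 by positivity)]
  have hπne : π ≠ 0 := hπ.ne'
  have key : ∀ A B C : ℝ,
      π ^ 2 * (17898 / 1000000 * (2 / π) * 1.15 * A + 2 / π ^ 2 * (1.15 : ℝ) ^ 2 * B + 2 / π ^ 2 * C)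
        = 2 * π * (17898 / 1000000) * 1.15 * A + 2 * (1.15 : ℝ) ^ 2 * B + 2 * C := by
    intro A B C
    field_simp
  rw [key]
  -- the enclosure of `π` (twenty digits) and of its even powers
  have hlo : (314159265358979323846 / 100000000000000000000 : ℝ) ≤ π := by
    have h := Real.pi_gt_d20; norm_num at h ⊢; exact h.le
  have hhi : π ≤ 314159265358979323847 / 100000000000000000000 := by
    have h := Real.pi_lt_d20; norm_num at h ⊢; exact h.le
  have l2 := pow_le_pow_left₀ (by norm_num) hlo 2
  have u2 := pow_le_pow_left₀ hπ.le hhi 2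
  have l4 := pow_le_pow_left₀ (by norm_num) hlo 4
  have u4 := pow_le_pow_left₀ hπ.le hhi 4
  have l6 := pow_le_pow_left₀ (by norm_num) hlo 6
  have u6 := pow_le_pow_left₀ hπ.le hhi 6
  have l8 := pow_le_pow_left₀ (by norm_num) hlo 8
  have u8 := pow_le_pow_left₀ hπ.le hhi 8
  have l10 := pow_le_pow_left₀ (by norm_num) hlo 10
  have u10 := pow_le_pow_left₀ hπ.le hhi 10
  have l12 := pow_le_pow_left₀ (by norm_num) hlo 12
  have u12 := pow_le_pow_left₀ hπ.le hhi 12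
  have l14 := pow_le_pow_left₀ (by norm_num) hlo 14
  have u14 := pow_le_pow_left₀ hπ.le hhi 14
  -- expand the finite Beta sums into an explicit even polynomial in `π` and compare
  simp only [Finset.sum_range_succ, Finset.sum_range_zero, Finset.prod_range_succ, Finset.prod_range_zero]
  norm_num [Nat.factorial]
  ring_nf
  linarith [l2, u2, l4, u4, l6, u6, l8, u8, l10, u10, l12, u12, l14, u14]

end Inoue2026.Numerics

/-- **Inoue 2026, the numerical line of the proof of Theorem 1, CERTIFIED IN THE KERNEL**
(`I_f(ℓ)⁻¹𝓜_{ℓ,f}(φ) − φ(1−φ) ≥ 10⁻⁵` at `φ = 0.508949`, `ℓ = 1.15`, `f(x) = 1 − 0.7x`, p. 3), for the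
records-v4 (correctly parenthesised, erratum E-ah-7) `Inoue2026.M`: discharge of the named claim
`inoue2026_numericalBound`.  Hence `inoue2026_theorem1` (`μ < 0.50895` on RH) is a theorem MODULO the
single claim `inoue2026_theorem2`, via `inoue2026_theorem1_of_theorem2 h2 inoue2026_numericalBound_holds`.
True value `≈ 1.487·10⁻⁵` (seat numerics, UNCERTIFIED; cell engine cross-check cc/engine/in26);
certified slack of this proof `≈ 4.6·10⁻⁶`.  NOT RH-BEARING.
[cite: Inoue2026, proof of Theorem 1 p. 3 ("≥ 10⁻⁵ > 0")] -/
theorem inoue2026_numericalBound_holds : inoue2026_numericalBound :=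
  Inoue2026.Numerics.mainTerm_lower

/-- **Inoue 2026, Theorem 1 from Theorem 2 alone** (the numerical node being kernel-certified):
`inoue2026_theorem2 → inoue2026_theorem1`. [claim: Inoue2026, status: under-review] -/
theorem inoue2026_theorem1_of_theorem2' (h2 : inoue2026_theorem2) : inoue2026_theorem1 :=
  inoue2026_theorem1_of_theorem2 h2 inoue2026_numericalBound_holds

end Literature.NumberTheory.LFunctions
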